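import Mathlib
import Literature.Geometry.Lorentzian.GiorgiKlainermanSzeftel2022.GRWTransformationAlgebra

/-!
# Giorgi–Klainerman–Szeftel, *Wave equations estimates and the nonlinear stability of slowly rotating Kerr black holes*,
# Appendix D.4.1 ("The sum", "The Z coefficients") and D.4.2 (Propositions D.4.3–D.4.4) — the `Z`-coefficient and
# rescaling ledger of the Chandrasekhar transformation `A ↦ Q(A) ↦ 𝔮 = q q̄³ Q(A)`

CITATION HEADER.
* `[J]` = the journal version, Pure Appl. Math. Q. **20** (2024), no. 7, doi:10.4310/pamq.241128023033 (bib key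
  `GiorgiKlainermanSzeftel2024`).  LOCATOR CONVENTION: `[J] p.N Lm` is line `m` of FILE page `N` of the per-page text
  layer of that PDF (`lit read doi:10.4310/pamq.241128023033 --pages N`), i.e. printed folio `N − 1`.  (The sibling
  module `GRWTransformationAlgebra` quotes printed folios instead; where a display is cited in both modules the two
  locators differ by one for this reason only.)
* `[v1]` = arXiv:2205.14808v1, TeX source `FinalKerrarxivversion.tex` (bib key `GiorgiKlainermanSzeftel2022`); a
  locator `[v1] l.N` is a TeX line number.
* Numbering.  `[v1]` Proposition `first-intermediate-step-main-theorem` / (`eq:first-assumptions-C1-C2`) /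
  (`final-commutator`) / (`Teuk-repeat=2`) are `[J]` Proposition D.4.1 / (D.4.3) / (D.4.4) / (D.4.2); `[v1]` Proposition
  `prop:wave-eq-Q` / (`wave-eq-Q`) / (`definition-tilde-V`) are `[J]` Proposition D.4.3 / (D.4.14) / (D.4.15); `[v1]`
  Proposition `prop:rescaling-f` / (`final-eq`) / (`definition-V-final`) are `[J]` Proposition D.4.4 / (D.4.17) /
  (D.4.18); `[v1]` (`Teukolsky-operator-ch5`) = `[J]` (5.1.2) (Proposition 5.1.1); `[v1]` (`wave-equation-Psi`) = `[J]`
  (4.7.12) (Corollary 4.7.9); `[v1]` (`eq:alternative-HovHb`) = `[J]` (D.2.1); `[v1]` (`eq:atrch-e3-atrchb-e4-pert-kerr`)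
  = `[J]` (4.1.14), whose exact-Kerr form (`eq:atrch-e3-atrch-e4-etaetab-kerr`) is the second identity of `[J]` (3.4.3);
  `[v1]` Lemma `lemma:equations-q` = `[J]` Lemma 3.4.1 (3.4.4); `[v1]` Lemma `lemma:definition-conformal-derivatives`
  / Proposition `prop-nullstr-conformal` = `[J]` Lemma 2.2.17 / Proposition 2.2.19; `[v1]` Definition
  `definition-hodge-duals` / Lemma `le:duals` / the wedge of real 1-forms = `[J]` Definition 2.1.7 / Lemma 2.1.10 /
  Definition 2.1.12; `[v1]` Definition `def:complexRicciandcurvaturecoefficients` = `[J]` Definition 2.4.8.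
* Glyphs.  The `[J]` text layer drops the under-bar accent (`tr χ` / `tr χ̲`, `η` / `η̲`, `H` / `H̲` print alike) and
  most large parentheses; every bar placement below was read on the `[v1]` TeX source, the `[J]` locus fixes the
  position of the display.  The two texts agree display by display in the part transcribed here (checked line by
  line); the one reading that the `[J]` layer cannot decide is PRINT DATUM (K).

WHAT IS TRANSCRIBED (and nothing else).  Writing `x = tr χ`, `y = tr χ̲`, `ρ`, and `C₁ = 2 tr χ̲`, `C₂ = ½ tr χ̲²` for the
`a = 0` parts of `[J]` (D.4.3):
* §0 the scalar package: `C₂` of (D.4.3) at `a = 0` is the `a = 0` value of `GRWTransformationAlgebra.C2` ((5.2.3); the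
  same for `C₁` is the landed `NTermWeightLedger.C1_a_zero`); the four transport values that the displayed `a = 0`
  lines of `[J]` pp.846–848 substitute
  (`∇₃^(c) tr χ̲ = −½ tr χ̲²`, `∇₃^(c) tr χ = −½ tr χ tr χ̲ + 2ρ`, `∇₃ ρ = −(3/2) tr χ̲ ρ`, `∇₄^(c) tr χ̲ = −½ tr χ tr χ̲ + 2ρ`)
  are entered as HYPOTHESES on two abstract derivations `d3`, `d4` (the conformal derivatives `∇₃^(c)`, `∇₄^(c)` of
  `[J]` Lemma 2.2.17 acting on scalars; no commutation of `d3`, `d4` is assumed) and, separately, CHECKED to be the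
  `a = 0` values of `[J]`'s own Kerr tables (`GRWTransformationAlgebra.trchO/trchbO/rho/ombO`, outgoing principal
  frame, `e₃ = −(Δ/|q|²)∂ᵣ`, `e₄ = ∂ᵣ`, with the conformal corrections `∓2sω̲` of Lemma 2.2.17 and `ω = 0`,
  `[J]` p.157 L97); the exact outgoing Kerr identity `∇₃^(c) tr χ̲ = −½(tr χ̲² − ⁽ᵃ⁾tr χ̲²)` (Proposition 2.2.19 with
  `χ̲̂ = ξ̲ = 0`) used in the `Z₄₃`, `Z₄` lines is checked on the same tables for all `a`;
* §1 "The sum" (`[J]` p.843 L5–p.844 L29 = `[v1]` l.34480–34538): the regrouping of `[Q, 𝓛]A` after substituting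
  `∇₃^(c)∇₃^(c)A = Q(A) − C₁∇₃^(c)A − C₂A` and its `∇`, `∇₄` derivatives, which DEFINES `V̂` and the coefficients
  `Z₄₃, Z₄, Z_{a3}, Z₃, Z_a, Z₀` — as a linear identity in a module (each horizontal contraction `u · (slot)` is linear in
  the slot, so the covectors `4η̲`, `tr X̲ + tr X̲‾`, … enter as scalar weights; the Hodge re-expression
  `(J_{*a}) · *∇A = −(*J_{*a}) · ∇A` of Lemma 2.1.10 is not modelled and its slot is carried separately);
* §2 the six-line table of `[J]` p.846 L5–27 (`[v1]` l.34592–34597): `∇₄C₁, ∇₃C₁, ∇₄∇₃C₁, ∇₄C₂, ∇₃C₂, ∇₄∇₃C₂` at `a = 0`;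
* §3 the `a = 0` values `I₃, J₃, K₃` (three printed lines), `L₃, N₃` (`[J]` p.846 L33–122), `I₃₃, J₃₃, K₃₃, M₃₃` and hence
  `V̂|_{a=0} = −(7/2) tr χ tr χ̲ − 8ρ` (p.847 L5–19), `I₀, J₀, K₀, L₀, N₀` (two printed lines) (p.847 L20–81), and the two
  cancellations `Z₃|_{a=0} = 0` (p.847 L85–103), `Z₀|_{a=0} = 0` (p.848 L5–28) which are the content of "all the `Z`
  coefficients are `O(|a|)`" for `Z₃`, `Z₀`; the comparison of the two printed forms of `I₃₃` ((D.4.9) p.830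
  vs p.847 L6) and the Kerr value of `η ∧ η̲`;
* §4 the exact (all `a`) lines for `Z₄₃` and `Z₄` (`[J]` p.844 L40–61, p.845 L7–30 = `[v1]` l.34551–34566): collection of
  `I₄₃ + J₄₃ + L₄₃ + C₁(tr X̲ + tr X̲‾)` and `I₄ + J₄ + L₄ + C₂(tr X̲ + tr X̲‾)` from the printed `I, J, L` lists, and the
  reduction to `∇₃C̃₁ + tr χ̲ C̃₁`, `∇₃C̃₂ + 2 tr χ̲ C̃₂ − ¼(tr χ̲² + ⁽ᵃ⁾tr χ̲²)C̃₁` using `tr X̲ = tr χ̲ − i ⁽ᵃ⁾tr χ̲`;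
* §5 Proposition D.4.3 (`[J]` p.848 L40–p.849 L57 = `[v1]` l.34665–34722): the first-order coefficient bookkeeping
  `□̇₂Q − 𝓛(Q)` from (4.7.12) and (5.1.2) with (D.4.4), and the potential `Ṽ` of (D.4.15) obtained from the last display
  of the proof by `tr X‾ tr X̲ = tr χ tr χ̲ + ⁽ᵃ⁾tr χ ⁽ᵃ⁾tr χ̲ + i(⁽ᵃ⁾tr χ tr χ̲ − tr χ ⁽ᵃ⁾tr χ̲)`, `P̄ = ρ − i *ρ`;
* §6 Proposition D.4.4 (`[J]` p.849 L64–p.851 L23 = `[v1]` l.34725–34790): the Leibniz rule for `f = qⁿ q̄ᵐ` under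
  Lemma 3.4.1, the collected coefficients of `∇₄Q, ∇₃Q, ∇Q` in `□̇₂(fQ)`, "the real parts are multiples of
  `m + n − 4`", the choice `m = 4 − n`, and `n = 1`, where the first-order operator becomes
  `i(⁽ᵃ⁾tr χ̲ ∇₄ + ⁽ᵃ⁾tr χ ∇₃ + 2(η + η̲) · *∇)` by `*ξ · ∇ = −ξ · *∇` (Lemma 2.1.10);
* §7 the frame identities `[J]` (3.4.3) (first and second) in exact Kerr, outgoing principal frame, component by
  component over `(∂ₜ, ∂ᵣ, ∂_θ, ∂_φ)` from the printed frame `[J]` p.126 L67–95 (= `[v1]` l.5683–5687), the canonical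
  horizontal basis (3.3.3) and the value tables of `GRWTransformationAlgebra` (`atrchO, atrchbO, eta1, eta2, etab1,
  etab2`): `⁽ᵃ⁾tr χ e₃ + ⁽ᵃ⁾tr χ̲ e₄ = (4a cos θ (r²+a²)/|q|⁴) T̂` and
  `⁽ᵃ⁾tr χ e₃ + ⁽ᵃ⁾tr χ̲ e₄ + 2(η + η̲) · *∇ = (4a cos θ/|q|²) ∂ₜ` — the identity by which Proposition D.4.4 ends.

WHAT IS CERTIFIED.  Identities in an arbitrary field `K` of characteristic zero (§1: any module over a commutative
ring).  Frame derivatives act on the scalars involved through derivations `Derivation ℤ K K` with the printed values as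
explicit hypotheses; `i` is an element with `i² = −1`, `|q|` an element `n` with `n² = r² + a² cos² θ`, `sin θ` an element
`s` with `s² + cos² θ = 1`; conjugates are written out.  Proofs are `simp`/`field_simp`/`ring`/`module` computations.
Every `O(|a| r^{−c})`, `Γ_b`, `Γ_g`, `Err[…]` term of the displays is OUTSIDE the statements: the theorems are the
`a = 0` (resp. exact) equalities of the explicitly printed algebra, which is what the displayed lines assert beyond
their error terms.

PRINT DATA located while certifying (proposed to the cell's lead as one E-entry, class E / PRINT precision, NIL: none
propagates to (D.4.4), (D.4.14)–(D.4.18) or Theorem 5.2.9, which use only `Z = O(|a|)`, `V̂`, `Ṽ` as certified here).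
* (K) `[v1]` l.34621 = `[J]` p.847 L12–17: "`K₃₃ = 2∇₃(−½ tr X − 2 tr X‾) = (5/2) tr χ tr χ − 10ρ + O(|a|r⁻³)`"
  (`\frac 5 2 \trch\trch`); with the transport value `∇₃^(c) tr χ = −½ tr χ̲ tr χ + 2ρ` that the same page uses for `K₃`
  (p.846 L84–85) the value is `(5/2) tr χ̲ tr χ − 10ρ` (`K33_azero`).  The slip is carried into the last factor of the
  `Z₃` and `Z₀` displays (`[v1]` l.34641, l.34647 = `[J]` p.847 L103, p.848 L28, "`− 5 tr χ̲ tr χ + (5/2) tr χ tr χ − 10ρ`"):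
  read literally those two displays sum to `5 tr χ tr χ̲ (tr χ̲ − tr χ)` and `(5/4) tr χ tr χ̲² (tr χ̲ − tr χ)`, not to
  `O(|a|)` (`Z3_azero_as_printed`, `Z0_azero_as_printed`); with (K) corrected both vanish identically (`Z3_azero`,
  `Z0_azero`), which is the stated conclusion.  The `[J]` text layer prints "trχtrχ" for either reading (glyph check on
  the PDF image OWED).
* (I) `[v1]` l.34619 = `[J]` p.847 L6 rewrites `I₃₃` as "`3P − 5P̄ + 4η · η̲ − 2|η|² + ∇₄C₁`", whereas (`eq:expression-I33`)
  `[v1]` l.34094–34096 = `[J]` (D.4.9) p.830 L61–74 has `I₃₃ = −2ρ − 2η · (η − 2η̲) + i(8 *ρ − 8 η ∧ η̲) + ∇₄C₁`; the rewrite omits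
  `−8i η ∧ η̲` (`I33_forms`), a term vanishing in Schwarzschild (`η ∧ η̲ = 2a³ r sin²θ cos θ/|q|⁶`, `eta_wedge_etab_kerr`),
  so the stated `I₃₃ = −tr χ tr χ̲ + 2ρ + O(|a|r⁻³)` is unaffected.
* (S) bookkeeping in "The sum": the `M`-expansion (`[v1]` l.34437 = `[J]` p.842) has terms `M₃ ∇₃A + M₀ A`; the sum
  `[v1]` l.34492/l.34503 = `[J]` p.843 L14/L30 lists `(I₃ + J₃ + K₃ + L₃ + N₃)∇₃A` without `M₃`, and `[v1]` l.34494/l.34505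
  = `[J]` p.843 L16/L32 lists `M₀` in the coefficient of `A` while the definition of `Z₀` (`[v1]` l.34537 = `[J]` p.844
  L28) omits it.  Both `M₃` and `M₀` are multiples of `4H + H̲ + H̲‾` and its derivatives, i.e. `O(|a|)`; the stated
  conclusion (all `Z` are `O(|a|)`) is unaffected.  §1 records the regrouping with the printed coefficient lists as
  opaque scalars, so it is neutral on (S).
* (W) the `ω`-bookkeeping of Proposition D.4.3 (a reading; immaterial at `ω = 0`).  The display "Applying the
  definition of 𝓛 …" (`[J]` p.848 L69–83 = `[v1]` l.34692–34695) re-expands `−∇₄^(c)∇₃^(c)Q` on the conformal-type-0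
  tensor `Q` (footnote p.848 L86) and prints `−2ω` inside the coefficient `(−½tr X − 2tr X‾ − 2ω)` of `∇₃Q`; Lemma
  2.2.17 as printed (`∇₄^(c)g = ∇₄g + 2sωg` on the type-`s = −1` tensor `g = ∇₃Q`) gives that term as `+2ω`; the next
  display (p.849 L14–23 = l.34697–34701) drops the `ω`-term altogether, and (4.7.12) contributes `(2ω − ½tr X)∇₃Q`.
  With the re-expansion term written `cω`, the coefficient of `∇₃Q` in (D.4.14) is `2tr X‾ + (2 − c)ω`
  (`waveQ_coeff3`): exactly the printed `2tr X‾` for `c = 2` (Lemma 2.2.17), `2tr X‾ + 4ω` for the printed `c = −2`,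
  `2tr X‾ + 2ω` for the second display's `c = 0` — all equal at `ω = 0`, which holds in Kerr in the outgoing
  normalization (`[J]` p.157 L97–99, footnote to Definition 4.1.2); in perturbations `ω = ω̌ ∈ Γ_g` and `ω∇₃Q` is an
  admissible error term of (D.4.14).

DIVERGENCE `[v1]` → `[J]`: none in the transcribed displays (the `[J]` text of D.4.1 "The sum"/"The Z coefficients" and of
D.4.2 coincides with `[v1]` l.34480–34790 line by line, including (K), (I), (S)).

v2 (2026-08-19, DOCSTRING-ONLY): `[v1]` line locators re-pinned to the display lines (the six-line table l.34592–34597,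
`Z₃` l.34639–34641, `Z₀` l.34645–34647 — REFEREE #69 P37 — and, by the same sweep, the Proposition 2.2.19 lines
l.4583/4588–4589/4597–4598, the outgoing Kerr table l.5735–5740, (D.4.9) l.34094–34096, "The sum" l.34492/34494/34503/34505,
the `M`-expansion l.34437, and the Proposition D.4.3/D.4.4 proof displays l.34697–34711, l.34747–34782); no declaration,
statement or proof changed.

NOT CLAIMED.  No statement about tensors, horizontal structures, the operators `Q`, `𝓛`, `□̇₂`, `L_Q`, the commutator
Propositions D.4.1–D.4.2 themselves (their `I, J, K, L, M, N` expansions are operator identities; only the displayed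
scalar coefficient algebra at `a = 0`, resp. the exact scalar lines for `Z₄₃, Z₄`, is checked), the product rule for
`□̇₂(fQ)`, the error terms, the `O(·)`/`Γ` bookkeeping, D.4.3 (Step 3: Proposition D.4.5, Lemma D.4.6 — these are in
`GRWTransformationAlgebra` §7) or D.5–D.7.  The transport values of §0 are hypotheses of the identities that use them
(and are separately checked against `[J]`'s Kerr tables); they are not asserted as facts about any spacetime.

STATUS-RELATION.  Imports `GRWTransformationAlgebra` (module of `[J]` §3.3/§5.2–5.3/D.3–D.4.3) for the value tables
`nsq, Del, trchO, atrchO, trchbO, atrchbO, ombO, rho, eta1, eta2, etab1, etab2`, the scalar `C2` and the helpers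
`D_num, D_ofNat, sqpow, nsq_ne_zero_of_sq`, BY NAME; nothing there is restated or modified.  `NTermWeightLedger` (module of
`[J]` §11.1/§11.3, which holds `C1_a_zero`) is referred to by name only and not imported.
-/

namespace Literature.Geometry.Lorentzian.GiorgiKlainermanSzeftel2022.ZCoefficientLedger

open Literature.Geometry.Lorentzian.GiorgiKlainermanSzeftel2022.GRWTransformationAlgebra

/-! ## §0. The scalar package of `[J]` (D.4.3) at `a = 0` and its provenance in the Kerr tables -/

section Package

variable {K : Type*} [Field K]

/-- `[J]` (D.4.3) at `a = 0`: `C₂ = ½ tr χ̲²`, as the `⁽ᵃ⁾tr χ̲ = 0` value of (5.2.3) (`GRWTransformationAlgebra.C2`); the companion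
`C₁ = 2 tr χ̲` at `a = 0` is the landed `NTermWeightLedger.C1_a_zero` (not restated here).
[cite: GiorgiKlainermanSzeftel2024, (D.4.3) p.823 L31–41, p.845 L64–66; GiorgiKlainermanSzeftel2022, l.33798, l.34587–34589] -/
theorem C2_azero (i y : K) : C2 i y 0 = 1 / 2 * y ^ 2 := by
  unfold C2; simp

variable [CharZero K]

/-- Provenance of the hypothesis `∇₃^(c) tr χ̲ = −½ tr χ̲²` (`a = 0`): on `[J]`'s outgoing Kerr tables at `a = 0`
(`tr χ̲ = −2rΔ/|q|⁴`, `ω̲ = ½∂ᵣ(Δ/|q|²)`, p.127 L130–175; `e₃ = −(Δ/|q|²)∂ᵣ`, p.126 L67–95) and with the conformal correction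
`∇₃^(c) = ∇₃ + 2ω̲` on the `(−1)`-conformal scalar `tr χ̲` (Lemma 2.2.17), `e₃(tr χ̲) + 2ω̲ tr χ̲ = −½ tr χ̲²`; this is
Proposition 2.2.19 (first line) in Schwarzschild.  Used at `[J]` p.846 L12 (`∇₃C₁ = −tr χ̲²`).
[cite: GiorgiKlainermanSzeftel2024, Lemma 2.2.17 p.105 L7–11, Proposition 2.2.19 p.105 L15–22, p.126 L67–95, p.127 L130–175, p.846 L12; GiorgiKlainermanSzeftel2022, l.4559–4568, l.4580–4583, l.5683–5687, l.5735–5740, l.34593] -/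
theorem sch_d3_trchb (D : Derivation ℤ K K) (r m c : K) (hr : r ≠ 0)
    (hDr : D r = -(Del r 0 m / nsq r 0 c)) (hDm : D m = 0) :
    D (trchbO r 0 m c) + 2 * ombO r 0 m c * trchbO r 0 m c = -(1 / 2) * trchbO r 0 m c ^ 2 := by
  obtain ⟨D2, -⟩ := D_num D
  unfold trchbO ombO Del nsq at *
  simp only [map_sub, map_neg, D.leibniz, D.leibniz_pow, D.leibniz_div, hDr, hDm, D2,
    smul_eq_mul, nsmul_eq_mul, Nat.cast_ofNat, mul_zero, zero_mul, add_zero, zero_add, sub_zero,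
    ne_eq, OfNat.ofNat_ne_zero, not_false_eq_true, zero_pow] at *
  field_simp
  ring

/-- Provenance of `∇₃^(c) tr χ = −½ tr χ̲ tr χ + 2ρ` (`a = 0`): with `tr χ = 2r/|q|²`, `ρ = −2m r³/|q|⁶ + …` at `a = 0` and
`∇₃^(c) = ∇₃ − 2ω̲` on the `(+1)`-conformal `tr χ`, `e₃(tr χ) − 2ω̲ tr χ = −½ tr χ tr χ̲ + 2ρ` (Proposition 2.2.19, fourth
line, in Schwarzschild).  Used at `[J]` p.846 L84–85 (`K₃`, second line: `∇₃(−(5/2)tr χ) = −(5/2)(−½ tr χ̲ tr χ + 2ρ)`).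
[cite: GiorgiKlainermanSzeftel2024, Proposition 2.2.19 p.105, p.846 L80–91; GiorgiKlainermanSzeftel2022, l.4588–4589, l.34607] -/
theorem sch_d3_trch (D : Derivation ℤ K K) (r m c : K) (hr : r ≠ 0)
    (hDr : D r = -(Del r 0 m / nsq r 0 c)) :
    D (trchO r 0 c) - 2 * ombO r 0 m c * trchO r 0 c
      = -(1 / 2) * trchO r 0 c * trchbO r 0 m c + 2 * rho r 0 m c := by
  obtain ⟨D2, -⟩ := D_num D
  unfold trchO trchbO ombO rho Del nsq at *
  simp only [D.leibniz, D.leibniz_pow, D.leibniz_div, hDr, D2,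
    smul_eq_mul, nsmul_eq_mul, Nat.cast_ofNat, mul_zero, zero_mul, add_zero, zero_add, sub_zero,
    ne_eq, OfNat.ofNat_ne_zero, not_false_eq_true, zero_pow] at *
  field_simp
  ring

/-- Provenance of `∇₃ρ = −(3/2) tr χ̲ ρ` (`a = 0`; `ρ` is `0`-conformal): on the outgoing tables at `a = 0`,
`e₃(ρ) = −(3/2) tr χ̲ ρ` — the reduced Bianchi identity `∇₃P = −(3/2) tr X̲ P` quoted in the proof of Lemma 3.4.1.
Used at `[J]` p.847 L74 (`N₀`: "`−5(−(3/2) tr χ̲ ρ) tr χ̲`") and in `I₃, J₀, L₀`.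
[cite: GiorgiKlainermanSzeftel2024, p.131 L25–28, p.847 L68–81; GiorgiKlainermanSzeftel2022, l.5936–5940, l.34633–34635] -/
theorem sch_d3_rho (D : Derivation ℤ K K) (r m c : K) (hr : r ≠ 0)
    (hDr : D r = -(Del r 0 m / nsq r 0 c)) (hDm : D m = 0) :
    D (rho r 0 m c) = -(3 / 2) * trchbO r 0 m c * rho r 0 m c := by
  obtain ⟨D2, D3, -, D6, -⟩ := D_num D
  unfold trchbO rho Del nsq at *
  simp only [map_neg, D.leibniz, D.leibniz_pow, D.leibniz_div, hDr, hDm, D2, D3, D6,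
    smul_eq_mul, nsmul_eq_mul, Nat.cast_ofNat, mul_zero, zero_mul, add_zero, sub_zero,
    ne_eq, OfNat.ofNat_ne_zero, not_false_eq_true, zero_pow] at *
  field_simp
  ring

/-- Provenance of `∇₄^(c) tr χ̲ = −½ tr χ tr χ̲ + 2ρ` (`a = 0`): outgoing `e₄ = ∂ᵣ` and `ω = 0` in Kerr (footnote to
Definition 4.1.2), so `∇₄^(c) = ∇₄` there; `∂ᵣ(tr χ̲) = −½ tr χ tr χ̲ + 2ρ` at `a = 0` (Proposition 2.2.19, `∇₄^(c)tr χ̲`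
line, in Schwarzschild).  Used at `[J]` p.846 L8 (`∇₄C₁ = −tr χ tr χ̲ + 4ρ`).
[cite: GiorgiKlainermanSzeftel2024, p.157 L97–99, Proposition 2.2.19 p.105, p.846 L5–9; GiorgiKlainermanSzeftel2022, l.7145, l.4597–4598, l.34592] -/
theorem sch_d4_trchb (E : Derivation ℤ K K) (r m c : K) (hr : r ≠ 0) (hEr : E r = 1) (hEm : E m = 0) :
    E (trchbO r 0 m c) = -(1 / 2) * trchO r 0 c * trchbO r 0 m c + 2 * rho r 0 m c := by
  obtain ⟨D2, -⟩ := D_num E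
  unfold trchO trchbO rho Del nsq at *
  simp only [map_sub, map_neg, E.leibniz, E.leibniz_pow, E.leibniz_div, hEr, hEm, D2,
    smul_eq_mul, nsmul_eq_mul, Nat.cast_ofNat, mul_zero, zero_mul, add_zero, sub_zero, mul_one,
    ne_eq, OfNat.ofNat_ne_zero, not_false_eq_true, zero_pow] at *
  field_simp
  ring

/-- The exact outgoing Kerr identity used in the `Z₄₃`, `Z₄` lines (`[J]` p.844 L54, p.845 L17–21: "`∇₃^(c)(2 tr χ̲) =
−(tr χ̲² − ⁽ᵃ⁾tr χ̲²) + r⁻¹Γ_b`"): on the tables `tr χ̲ = −2rΔ/|q|⁴`, `⁽ᵃ⁾tr χ̲ = 2aΔcos θ/|q|⁴`, `ω̲`, with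
`e₃ = −(Δ/|q|²)∂ᵣ` on functions of `(r, cos θ)` and `∇₃^(c) = ∇₃ + 2ω̲` on `tr χ̲`,
`e₃(tr χ̲) + 2ω̲ tr χ̲ = −½(tr χ̲² − ⁽ᵃ⁾tr χ̲²)` for all `a` (Proposition 2.2.19, first line, with `χ̲̂ = ξ̲ = 0` in Kerr).
[cite: GiorgiKlainermanSzeftel2024, Proposition 2.2.19 p.105 L15–22, p.126 L67–95, p.127 L130–175, p.844 L49–61; GiorgiKlainermanSzeftel2022, l.4583, l.5683–5687, l.5735–5740, l.34555–34557] -/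
theorem e3c_trchb_out (D : Derivation ℤ K K) (r a m c : K) (hN : nsq r a c ≠ 0)
    (hDr : D r = -(Del r a m / nsq r a c)) (hDa : D a = 0) (hDm : D m = 0) (hDc : D c = 0) :
    D (trchbO r a m c) + 2 * ombO r a m c * trchbO r a m c
      = -(1 / 2) * (trchbO r a m c ^ 2 - atrchbO r a m c ^ 2) := by
  obtain ⟨D2, -⟩ := D_num D
  unfold trchbO atrchbO ombO Del at *
  unfold nsq at *
  simp only [map_add, map_sub, map_neg, D.leibniz, D.leibniz_pow, D.leibniz_div, hDr, hDa, hDm, hDc, D2,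
    smul_eq_mul, nsmul_eq_mul, Nat.cast_ofNat, mul_zero, add_zero,
    smul_zero] at *
  field_simp
  ring

end Package

/-! ## §1. "The sum": the regrouping that defines `V̂` and the `Z` coefficients (`[J]` p.843 L5 – p.844 L29) -/

section Sum

variable {R : Type*} [CommRing R] {M : Type*} [AddCommGroup M] [Module R M]

/-- `[J]` p.843 L20 – p.844 L29 (`[v1]` l.34497–34538).  Slots (elements of a module `M`): `gQ = ∇Q(A)`, `g4Q = ∇₄Q(A)`,
`sQ = Q(A)`, `g33 = ∇∇₃∇₃A`, `n433 = ∇₄∇₃∇₃A`, `s33 = ∇₃∇₃A`, `s43 = ∇₄∇₃A`, `s4 = ∇₄A`, `sa3 = ∇∇₃A`, `s3 = ∇₃A`,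
`sa = ∇A`, `sda = *∇A`, `s0 = A`, and the opaque terms `j3 = J₃ᵃ(A)`, `j0 = J₀ᵃ(A)` (all derivatives conformal).
Scalars: `e` the weight of the contraction with `4η̲`, `tb = tr X̲ + tr X̲‾`, `gC1 = ∇C₁`, `g4C1 = ∇₄C₁`, `gC2 = ∇C₂`,
`g4C2 = ∇₄C₂`, and the printed coefficient sums `S43 = I₄₃+J₄₃+L₄₃`, `S4 = I₄+J₄+L₄`, `S33 = I₃₃+J₃₃+K₃₃+M₃₃`,
`Sa3 = I_{a3}+J_{a3}+L_{a3}+M_{a3}`, `S3 = I₃+J₃+K₃+L₃+N₃`, `Sa = J_a+L_a+M_a`, `Sda = J_{*a}`, `S0 = I₀+J₀+K₀+L₀+M₀+N₀`.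
Substituting "`∇₃∇₃A = Q(A) − C₁∇₃A − C₂A`" and its two differentiated forms (p.843 L36–52) into the second display of
"The sum" gives the display "Hence, `[Q, 𝓛]A = 4η̲·∇Q − 2tr χ̲ ∇₄Q + V̂ Q + Z₄₃∇₄∇₃A + …`" with `V̂ = S33` and exactly the
printed `Z₄₃ = S43 + C₁ tb`, `Z₄ = S4 + C₂ tb`, `Z_{a3} = Sa3 − 4C₁η̲`, `Z₃ = S3 − 4η̲·∇C₁ + ∇₄C₁ tb − C₁ S33 (+J₃ᵃ)`,
`Z_a = Sa − 4C₂η̲ (−*J_{*a})`, `Z₀ = S0 − 4η̲·∇C₂ + ∇₄C₂ tb − C₂ S33 (+J₀ᵃ)` (scalar shadow of the contractions; the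
`*∇A` slot is kept as printed before the use of Lemma 2.1.10; PRINT DATUM (S) concerns which terms the paper puts into
`S3`, `S0` and is invisible at this level).
[cite: GiorgiKlainermanSzeftel2024, p.843 L5–52, p.844 L5–29; GiorgiKlainermanSzeftel2022, l.34480–34538] -/
theorem sum_regroup
    (e tb C1 C2 gC1 g4C1 gC2 g4C2 S43 S4 S33 Sa3 S3 Sa Sda S0 : R)
    (sQ gQ g4Q g33 n433 s33 s43 s4 sa3 s3 sa sda s0 j3 j0 : M)
    (h33 : s33 = sQ - C1 • s3 - C2 • s0)
    (hg : g33 = gQ - C1 • sa3 - gC1 • s3 - C2 • sa - gC2 • s0)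
    (hn : n433 = g4Q - C1 • s43 - C2 • s4 - g4C1 • s3 - g4C2 • s0) :
    e • g33 - tb • n433 + S43 • s43 + S4 • s4 + S33 • s33 + Sa3 • sa3 + (S3 • s3 + j3)
        + Sa • sa + Sda • sda + (S0 • s0 + j0)
      = e • gQ - tb • g4Q + S33 • sQ
        + (S43 + C1 * tb) • s43 + (S4 + C2 * tb) • s4 + (Sa3 - C1 * e) • sa3
        + ((S3 - e * gC1 + g4C1 * tb - C1 * S33) • s3 + j3) + (Sa - C2 * e) • sa + Sda • sda
        + ((S0 - e * gC2 + g4C2 * tb - C2 * S33) • s0 + j0) := by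
  subst h33 hg hn
  module

/-- The two exact consequences used for the `Q`-terms: `tr X̲ + tr X̲‾ = 2 tr χ̲` with `tr X̲ = tr χ̲ − i ⁽ᵃ⁾tr χ̲`
(Definition 2.4.8), so `−(tr X̲ + tr X̲‾)∇₄Q = −2 tr χ̲ ∇₄Q` as printed in (D.4.4).
[cite: GiorgiKlainermanSzeftel2024, Definition 2.4.8 p.113 L29–60, (D.4.4) p.823 L45–50, p.843 L44–50; GiorgiKlainermanSzeftel2022, l.5053, l.33803–33806, l.34521] -/
theorem trXb_add_conj (i y y' : R) : (y - i * y') + (y + i * y') = 2 * y := by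
  ring

end Sum

/-! ## §2. The table of `[J]` p.846 L5–27: derivatives of `C₁ = 2 tr χ̲`, `C₂ = ½ tr χ̲²` at `a = 0` -/

section Table

variable {K : Type*} [Field K] [CharZero K]

/-- Line 1: `∇₄C₁ = −tr χ tr χ̲ + 4ρ (+O(|a|r⁻³) + r⁻¹Γ_g)`.
[cite: GiorgiKlainermanSzeftel2024, p.846 L5–9; GiorgiKlainermanSzeftel2022, l.34592] -/
theorem dtab_d4C1 (d4 : Derivation ℤ K K) (x y ρ : K) (h4y : d4 y = -(1 / 2) * x * y + 2 * ρ) :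
    d4 (2 * y) = -(x * y) + 4 * ρ := by
  obtain ⟨D2, -⟩ := D_num d4
  simp only [d4.leibniz, h4y, D2, smul_eq_mul, mul_zero, add_zero]
  ring

/-- Line 2: `∇₃C₁ = −tr χ̲² (+…)`.
[cite: GiorgiKlainermanSzeftel2024, p.846 L10–12; GiorgiKlainermanSzeftel2022, l.34593] -/
theorem dtab_d3C1 (d3 : Derivation ℤ K K) (y : K) (h3y : d3 y = -(1 / 2) * y ^ 2) :
    d3 (2 * y) = -(y ^ 2) := by
  obtain ⟨D2, -⟩ := D_num d3
  simp only [d3.leibniz, h3y, D2, smul_eq_mul, mul_zero, add_zero]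
  ring

/-- Line 3: `∇₄∇₃C₁ = tr χ tr χ̲² − 4 tr χ̲ ρ (+…)` (as `∇₄` applied to line 2).
[cite: GiorgiKlainermanSzeftel2024, p.846 L13–14; GiorgiKlainermanSzeftel2022, l.34594] -/
theorem dtab_d4d3C1 (d3 d4 : Derivation ℤ K K) (x y ρ : K) (h3y : d3 y = -(1 / 2) * y ^ 2)
    (h4y : d4 y = -(1 / 2) * x * y + 2 * ρ) :
    d4 (d3 (2 * y)) = x * y ^ 2 - 4 * y * ρ := by
  obtain ⟨D2, -⟩ := D_num d3
  obtain ⟨E2, -⟩ := D_num d4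
  simp only [d3.leibniz, d4.leibniz, d4.leibniz_pow, map_neg, h3y, h4y, D2, E2, smul_eq_mul,
    nsmul_eq_mul, Nat.cast_ofNat, mul_zero, add_zero, pow_one,
    Nat.add_one_sub_one, d4.leibniz_div, Derivation.map_one_eq_zero, sub_zero]
  ring

/-- Line 4: `∇₄C₂ = −½ tr χ tr χ̲² + 2 tr χ̲ ρ (+…)`.
[cite: GiorgiKlainermanSzeftel2024, p.846 L15–18; GiorgiKlainermanSzeftel2022, l.34595] -/
theorem dtab_d4C2 (d4 : Derivation ℤ K K) (x y ρ : K) (h4y : d4 y = -(1 / 2) * x * y + 2 * ρ) :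
    d4 (1 / 2 * y ^ 2) = -(1 / 2) * x * y ^ 2 + 2 * y * ρ := by
  obtain ⟨E2, -⟩ := D_num d4
  simp only [d4.leibniz, d4.leibniz_pow, d4.leibniz_div, h4y, E2, smul_eq_mul,
    nsmul_eq_mul, Nat.cast_ofNat, mul_zero, add_zero, pow_one,
    Nat.add_one_sub_one, Derivation.map_one_eq_zero, sub_zero]
  ring

/-- Line 5: `∇₃C₂ = −½ tr χ̲³ (+…)`.
[cite: GiorgiKlainermanSzeftel2024, p.846 L19–22; GiorgiKlainermanSzeftel2022, l.34596] -/
theorem dtab_d3C2 (d3 : Derivation ℤ K K) (y : K) (h3y : d3 y = -(1 / 2) * y ^ 2) :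
    d3 (1 / 2 * y ^ 2) = -(1 / 2) * y ^ 3 := by
  obtain ⟨D2, -⟩ := D_num d3
  simp only [d3.leibniz, d3.leibniz_pow, d3.leibniz_div, h3y, D2, smul_eq_mul,
    nsmul_eq_mul, Nat.cast_ofNat, mul_zero, add_zero, pow_one,
    Nat.add_one_sub_one, Derivation.map_one_eq_zero, sub_zero]
  ring

/-- Line 6: `∇₄∇₃C₂ = ¾ tr χ tr χ̲³ − 3 tr χ̲² ρ (+…)` (as `∇₄` applied to line 5).
[cite: GiorgiKlainermanSzeftel2024, p.846 L23–27; GiorgiKlainermanSzeftel2022, l.34597] -/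
theorem dtab_d4d3C2 (d3 d4 : Derivation ℤ K K) (x y ρ : K) (h3y : d3 y = -(1 / 2) * y ^ 2)
    (h4y : d4 y = -(1 / 2) * x * y + 2 * ρ) :
    d4 (d3 (1 / 2 * y ^ 2)) = 3 / 4 * x * y ^ 3 - 3 * y ^ 2 * ρ := by
  obtain ⟨D2, -⟩ := D_num d3
  obtain ⟨E2, E3, -⟩ := D_num d4
  simp only [d3.leibniz, d3.leibniz_pow, d3.leibniz_div, d4.leibniz, d4.leibniz_pow, d4.leibniz_div, map_neg,
    h3y, h4y, D2, E2, smul_eq_mul, nsmul_eq_mul, Nat.cast_ofNat, mul_zero, add_zero,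
    pow_one, Nat.add_one_sub_one, Derivation.map_one_eq_zero, sub_zero]
  ring

end Table

/-! ## §3. The `a = 0` coefficient values and the cancellations `Z₃ = Z₀ = 0` (`[J]` pp.846–848) -/

section Coefficients

variable {K : Type*} [Field K] [CharZero K]

/-- `I₃` (`[J]` p.846 L33–40): "`I₃ = −∇₃(2ρ) − 2tr χ̲(2ρ) − ½tr χ tr χ̲² + 2tr χ̲ ρ + tr χ tr χ̲² − 4tr χ̲ ρ = ½tr χ tr χ̲² −
3tr χ̲ ρ`" (`+O(|a|r⁻⁴)`), using `∇₃ρ = −(3/2)tr χ̲ ρ`.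
[cite: GiorgiKlainermanSzeftel2024, p.846 L33–40; GiorgiKlainermanSzeftel2022, l.34602–34603] -/
theorem I3_azero (d3 : Derivation ℤ K K) (x y ρ : K) (h3ρ : d3 ρ = -(3 / 2) * y * ρ) :
    -d3 (2 * ρ) - 2 * y * (2 * ρ) - 1 / 2 * x * y ^ 2 + 2 * y * ρ + x * y ^ 2 - 4 * y * ρ
      = 1 / 2 * x * y ^ 2 - 3 * y * ρ := by
  obtain ⟨D2, -⟩ := D_num d3
  simp only [d3.leibniz, h3ρ, D2, smul_eq_mul, mul_zero, add_zero]
  ring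

/-- `J₃` (`[J]` p.846 L47–60): "`J₃ = −2tr χ̲(∇₃((5/2)tr χ) + tr χ tr χ̲) + (−(5/2)tr χ̲²)((5/2)tr χ) = −(23/4)tr χ tr χ̲² −
10 tr χ̲ ρ`", using `∇₃^(c)tr χ = −½tr χ̲ tr χ + 2ρ`.
[cite: GiorgiKlainermanSzeftel2024, p.846 L47–60; GiorgiKlainermanSzeftel2022, l.34604–34605] -/
theorem J3_azero (d3 : Derivation ℤ K K) (x y ρ : K) (h3x : d3 x = -(1 / 2) * x * y + 2 * ρ) :
    -(2 * y) * (d3 (5 / 2 * x) + x * y) + -(5 / 2 * y ^ 2) * (5 / 2 * x)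
      = -(23 / 4) * x * y ^ 2 - 10 * y * ρ := by
  obtain ⟨D2, -, -, -, -⟩ := D_num d3
  have D5 : d3 (5 : K) = 0 := D_ofNat d3 5
  simp only [d3.leibniz, d3.leibniz_div, h3x, D2, D5, smul_eq_mul, mul_zero, add_zero, sub_zero
    ]
  ring

/-- `K₃`, first printed line equals the value: "`K₃ = ∇₃∇₃(−(5/2)tr χ) + 2tr χ̲ ∇₃(−(5/2)tr χ) + (5/2)tr χ(−tr χ̲²) = … =
−(5/4)tr χ̲² tr χ`", using all three `∇₃` values.
[cite: GiorgiKlainermanSzeftel2024, p.846 L65–109; GiorgiKlainermanSzeftel2022, l.34606–34610] -/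
theorem K3_azero_line1 (d3 : Derivation ℤ K K) (x y ρ : K) (h3y : d3 y = -(1 / 2) * y ^ 2)
    (h3x : d3 x = -(1 / 2) * x * y + 2 * ρ) (h3ρ : d3 ρ = -(3 / 2) * y * ρ) :
    d3 (d3 (-(5 / 2) * x)) + 2 * y * d3 (-(5 / 2) * x) + 5 / 2 * x * -(y ^ 2) = -(5 / 4) * y ^ 2 * x := by
  obtain ⟨D2, -, -, -, -⟩ := D_num d3
  have D5 : d3 (5 : K) = 0 := D_ofNat d3 5
  simp only [d3.leibniz, d3.leibniz_div, map_neg, map_add, h3x, h3y, h3ρ, D2,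
    D5, smul_eq_mul, mul_zero, add_zero, sub_zero,
    Derivation.map_one_eq_zero, neg_zero]
  ring

/-- `K₃`, second printed line: "`= −(5/2)∇₃(−½tr χ̲ tr χ + 2ρ) − 5tr χ̲(−½tr χ̲ tr χ + 2ρ) + (5/2)tr χ(−tr χ̲²)`" has the
same value `−(5/4)tr χ̲² tr χ`.
[cite: GiorgiKlainermanSzeftel2024, p.846 L80–91; GiorgiKlainermanSzeftel2022, l.34607–34608] -/
theorem K3_azero_line2 (d3 : Derivation ℤ K K) (x y ρ : K) (h3y : d3 y = -(1 / 2) * y ^ 2)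
    (h3x : d3 x = -(1 / 2) * x * y + 2 * ρ) (h3ρ : d3 ρ = -(3 / 2) * y * ρ) :
    -(5 / 2) * d3 (-(1 / 2) * y * x + 2 * ρ) - 5 * y * (-(1 / 2) * y * x + 2 * ρ) + 5 / 2 * x * -(y ^ 2)
      = -(5 / 4) * y ^ 2 * x := by
  obtain ⟨D2, -, -, -, -⟩ := D_num d3
  simp only [d3.leibniz, d3.leibniz_div, map_neg, map_add, h3x, h3y, h3ρ, D2,
    smul_eq_mul, mul_zero, add_zero, sub_zero,
    Derivation.map_one_eq_zero, neg_zero]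
  ring

/-- `K₃`, third printed line: "`= −(5/2)(¼tr χ̲² tr χ − ½tr χ̲(−½tr χ̲ tr χ + 2ρ) − 3tr χ̲ ρ) − 10tr χ̲ ρ`" (the inner
bracket being `∇₃(−½tr χ̲ tr χ + 2ρ)`) equals `−(5/4)tr χ̲² tr χ`; and the inner bracket is indeed that derivative.
[cite: GiorgiKlainermanSzeftel2024, p.846 L97–109; GiorgiKlainermanSzeftel2022, l.34609–34610] -/
theorem K3_azero_line3 (d3 : Derivation ℤ K K) (x y ρ : K) (h3y : d3 y = -(1 / 2) * y ^ 2)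
    (h3x : d3 x = -(1 / 2) * x * y + 2 * ρ) (h3ρ : d3 ρ = -(3 / 2) * y * ρ) :
    d3 (-(1 / 2) * y * x + 2 * ρ) = 1 / 4 * y ^ 2 * x - 1 / 2 * y * (-(1 / 2) * y * x + 2 * ρ) - 3 * y * ρ
    ∧ -(5 / 2) * (1 / 4 * y ^ 2 * x - 1 / 2 * y * (-(1 / 2) * y * x + 2 * ρ) - 3 * y * ρ) - 10 * y * ρ
      = -(5 / 4) * y ^ 2 * x := by
  obtain ⟨D2, -, -, -, -⟩ := D_num d3
  refine ⟨?_, by ring⟩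
  simp only [d3.leibniz, d3.leibniz_div, map_neg, map_add, h3x, h3y, h3ρ, D2,
    smul_eq_mul, mul_zero, add_zero, sub_zero,
    Derivation.map_one_eq_zero, neg_zero]
  ring

/-- `L₃` (`[J]` p.846 L112–116): "`L₃ = −½tr χ̲(6ρ − (−tr χ tr χ̲ + 4ρ)) = −½tr χ tr χ̲² − tr χ̲ ρ`".
[cite: GiorgiKlainermanSzeftel2024, p.846 L112–116; GiorgiKlainermanSzeftel2022, l.34613] -/
theorem L3_azero (x y ρ : K) :
    -(1 / 2) * y * (6 * ρ - (-(x * y) + 4 * ρ)) = -(1 / 2) * x * y ^ 2 - y * ρ := by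
  ring

/-- `N₃` (`[J]` p.846 L118–122): "`N₃ = 2(−∇₃tr χ tr χ̲ − tr χ ∇₃tr χ̲ + 2∇₃ρ) = 2tr χ tr χ̲² − 10ρ tr χ̲`".
[cite: GiorgiKlainermanSzeftel2024, p.846 L118–122; GiorgiKlainermanSzeftel2022, l.34614–34615] -/
theorem N3_azero (d3 : Derivation ℤ K K) (x y ρ : K) (h3y : d3 y = -(1 / 2) * y ^ 2)
    (h3x : d3 x = -(1 / 2) * x * y + 2 * ρ) (h3ρ : d3 ρ = -(3 / 2) * y * ρ) :
    2 * (-(d3 x) * y - x * d3 y + 2 * d3 ρ) = 2 * x * y ^ 2 - 10 * ρ * y := by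
  rw [h3x, h3y, h3ρ]
  ring

/-- `I₃₃` at `a = 0` (`[J]` p.847 L6): "`I₃₃ = 3P − 5P̄ + 4η·η̲ − 2|η|² + ∇₄C₁ = −tr χ tr χ̲ + 2ρ`" with `P = P̄ = ρ`,
`η = η̲ = 0` at `a = 0` and line 1 of the table.
[cite: GiorgiKlainermanSzeftel2024, p.847 L5–6; GiorgiKlainermanSzeftel2022, l.34619] -/
theorem I33_azero (d4 : Derivation ℤ K K) (x y ρ : K) (h4y : d4 y = -(1 / 2) * x * y + 2 * ρ) :
    3 * ρ - 5 * ρ + 4 * 0 - 2 * 0 + d4 (2 * y) = -(x * y) + 2 * ρ := by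
  rw [dtab_d4C1 d4 x y ρ h4y]
  ring

omit [CharZero K] in
/-- PRINT DATUM (I).  The general `I₃₃` of (D.4.9) (`[v1]` (`eq:expression-I33`)) is `−2ρ − 2η·(η − 2η̲) + i(8*ρ − 8η∧η̲) + ∇₄C₁`; the
rewritten form "`3P − 5P̄ + 4η·η̲ − 2|η|² + ∇₄C₁`" of p.847 L6, with `P = ρ + i*ρ` (Definition 2.4.8), `|η|² = η·η`,
equals the former PLUS `8i η∧η̲` (symbols: `sr = *ρ`, `ee = η·η̲`, `e2 = |η|²`, `ew = η∧η̲`, `D = ∇₄C₁`).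
[cite: GiorgiKlainermanSzeftel2024, p.847 L5–6, (D.4.9) p.830 L61–74; GiorgiKlainermanSzeftel2022, l.34619, l.34094–34096] -/
theorem I33_forms (i ρ sr ee e2 ew D : K) :
    3 * (ρ + i * sr) - 5 * (ρ - i * sr) + 4 * ee - 2 * e2 + D
      = (-2 * ρ - 2 * (e2 - 2 * ee) + i * (8 * sr - 8 * ew) + D) + 8 * i * ew := by
  ring

omit [CharZero K] in
/-- The omitted term of (I) vanishes in Schwarzschild: in Kerr (canonical basis, `GRWTransformationAlgebra.eta1/eta2/
etab1/etab2`) `η ∧ η̲ = η₁η̲₂ − η₂η̲₁ = 2a³ r sin²θ cos θ/|q|⁶` (`∈₁₂ = 1`, Definition 2.1.12), a multiple of `a³`.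
[cite: GiorgiKlainermanSzeftel2024, Definition 2.1.12 p.69 L10–13, p.124 L86–131, p.127 L166–202; GiorgiKlainermanSzeftel2022, l.2759, l.5559–5566, l.5741–5748] -/
theorem eta_wedge_etab_kerr (r a c s n : K) (hn0 : n ≠ 0) :
    eta1 a c s n * etab2 r a s n - eta2 r a s n * etab1 a c s n = 2 * a ^ 3 * r * s ^ 2 * c / n ^ 6 := by
  unfold eta1 eta2 etab1 etab2
  field_simp
  ring

/-- `J₃₃` at `a = 0` (`[J]` p.847 L7–9): "`J₃₃ = −(tr X̲ + tr X̲‾)(½tr X + 2tr X‾) + 𝒟·H̄ + 2H·H̄ = −5 tr χ̲ tr χ`" with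
`tr X̲ = tr X̲‾ = tr χ̲`, `tr X = tr X‾ = tr χ`, `H = 0` at `a = 0`.
[cite: GiorgiKlainermanSzeftel2024, p.847 L7–9; GiorgiKlainermanSzeftel2022, l.34620] -/
theorem J33_azero (x y : K) : -(y + y) * (1 / 2 * x + 2 * x) + 0 + 2 * 0 = -5 * y * x := by
  ring

/-- `K₃₃` at `a = 0` — the CORRECT value: "`K₃₃ = 2∇₃(−½tr X − 2tr X‾)`" `= −5∇₃^(c)tr χ = (5/2) tr χ tr χ̲ − 10ρ`.
PRINT DATUM (K): `[J]` p.847 L12–17 = `[v1]` l.34621 print "`(5/2) tr χ tr χ − 10ρ`" (`\trch\trch`).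
[cite: GiorgiKlainermanSzeftel2024, p.847 L12–17; GiorgiKlainermanSzeftel2022, l.34621] -/
theorem K33_azero (d3 : Derivation ℤ K K) (x y ρ : K) (h3x : d3 x = -(1 / 2) * x * y + 2 * ρ) :
    2 * d3 (-(1 / 2) * x - 2 * x) = 5 / 2 * x * y - 10 * ρ := by
  obtain ⟨D2, -⟩ := D_num d3
  simp only [d3.leibniz, d3.leibniz_div, map_neg, map_sub, h3x, D2, smul_eq_mul, mul_zero,
    add_zero, sub_zero, Derivation.map_one_eq_zero, neg_zero]
  ring

/-- The printed `K₃₃` of (K) differs from the derived one by `(5/2) tr χ (tr χ − tr χ̲)`, nonzero in Schwarzschild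
(`tr χ = 2/r`, `tr χ̲ = −2Δ/r³`).
[cite: GiorgiKlainermanSzeftel2024, p.847 L12–17; GiorgiKlainermanSzeftel2022, l.34621] -/
theorem K33_print_gap (x y ρ : K) :
    (5 / 2 * x * x - 10 * ρ) - (5 / 2 * x * y - 10 * ρ) = 5 / 2 * x * (x - y) := by
  ring

/-- `V̂ = I₃₃ + J₃₃ + K₃₃ + M₃₃` ((D.4.5)) at `a = 0`, with `M₃₃ = 2(4H + H̲ + H̲‾)·η = 0` there:
`V̂|_{a=0} = (−tr χ tr χ̲ + 2ρ) + (−5tr χ̲ tr χ) + ((5/2)tr χ tr χ̲ − 10ρ) + 0 = −(7/2) tr χ tr χ̲ − 8ρ` — the bracket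
"`−tr χ tr χ̲ + 2ρ − 5tr χ̲ tr χ + (5/2)tr χ̲ tr χ − 10ρ`" of the `Z₃`, `Z₀` displays ((K) corrected).
[cite: GiorgiKlainermanSzeftel2024, (D.4.5) p.823 L52–58, p.847 L5–19, L103; GiorgiKlainermanSzeftel2022, l.33812–33814, l.34618–34623] -/
theorem Vhat_azero (x y ρ : K) :
    (-(x * y) + 2 * ρ) + (-5 * y * x) + (5 / 2 * x * y - 10 * ρ) + 0 = -(7 / 2) * x * y - 8 * ρ := by
  ring

/-- `I₀ = ∇₄∇₃C₂ = ¾tr χ tr χ̲³ − 3tr χ̲² ρ` (`[J]` p.847 L22, L32–34) is line 6 of the table (`dtab_d4d3C2`); `J₀`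
(p.847 L37–51): "`J₀ = −2tr χ̲(∇₃(tr χ tr χ̲ − 2ρ) + ½tr χ̲(4ρ)) + (−(5/2)tr χ̲²)(tr χ tr χ̲ − 2ρ) = −½tr χ tr χ̲³ − 9ρ tr χ̲²`".
[cite: GiorgiKlainermanSzeftel2024, p.847 L37–51; GiorgiKlainermanSzeftel2022, l.34627–34629] -/
theorem J0_azero (d3 : Derivation ℤ K K) (x y ρ : K) (h3y : d3 y = -(1 / 2) * y ^ 2)
    (h3x : d3 x = -(1 / 2) * x * y + 2 * ρ) (h3ρ : d3 ρ = -(3 / 2) * y * ρ) :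
    -(2 * y) * (d3 (x * y - 2 * ρ) + 1 / 2 * y * (4 * ρ)) + -(5 / 2 * y ^ 2) * (x * y - 2 * ρ)
      = -(1 / 2) * x * y ^ 3 - 9 * ρ * y ^ 2 := by
  obtain ⟨D2, -⟩ := D_num d3
  simp only [d3.leibniz, map_sub, h3x, h3y, h3ρ, D2, smul_eq_mul, mul_zero, add_zero
    ]
  ring

/-- `K₀` (p.847 L53–57): "`K₀ = −(−½tr X − 2tr X‾)∇₃C₂ = −(5/4)tr χ tr χ̲³`" with line 5 of the table.
[cite: GiorgiKlainermanSzeftel2024, p.847 L53–57; GiorgiKlainermanSzeftel2022, l.34630] -/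
theorem K0_azero (d3 : Derivation ℤ K K) (x y : K) (h3y : d3 y = -(1 / 2) * y ^ 2) :
    -(-(1 / 2) * x - 2 * x) * d3 (1 / 2 * y ^ 2) = -(5 / 4) * x * y ^ 3 := by
  rw [dtab_d3C2 d3 y h3y]
  ring

/-- `L₀` (p.847 L58–65): "`L₀ = −2tr χ̲² ρ + ½tr χ̲(−½tr χ tr χ̲² + 2tr χ̲ ρ) − 2tr χ̲ ∇₃(ρ) = −¼tr χ tr χ̲³ + 2tr χ̲² ρ`".
[cite: GiorgiKlainermanSzeftel2024, p.847 L58–65; GiorgiKlainermanSzeftel2022, l.34631–34632] -/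
theorem L0_azero (d3 : Derivation ℤ K K) (x y ρ : K) (h3ρ : d3 ρ = -(3 / 2) * y * ρ) :
    -2 * y ^ 2 * ρ + 1 / 2 * y * (-(1 / 2) * x * y ^ 2 + 2 * y * ρ) - 2 * y * d3 ρ
      = -(1 / 4) * x * y ^ 3 + 2 * y ^ 2 * ρ := by
  rw [h3ρ]
  ring

/-- `N₀`, first line equals the value (p.847 L68–81): "`N₀ = ∇₃∇₃(−tr χ tr χ̲ + 2ρ) + 2tr χ̲ ∇₃(−tr χ tr χ̲ + 2ρ) = … =
½tr χ tr χ̲³ + 2ρ tr χ̲²`", with all three `∇₃` values.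
[cite: GiorgiKlainermanSzeftel2024, p.847 L68–81; GiorgiKlainermanSzeftel2022, l.34633–34635] -/
theorem N0_azero_line1 (d3 : Derivation ℤ K K) (x y ρ : K) (h3y : d3 y = -(1 / 2) * y ^ 2)
    (h3x : d3 x = -(1 / 2) * x * y + 2 * ρ) (h3ρ : d3 ρ = -(3 / 2) * y * ρ) :
    d3 (d3 (-(x * y) + 2 * ρ)) + 2 * y * d3 (-(x * y) + 2 * ρ) = 1 / 2 * x * y ^ 3 + 2 * ρ * y ^ 2 := by
  obtain ⟨D2, D3, -⟩ := D_num d3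
  simp only [d3.leibniz, d3.leibniz_pow, d3.leibniz_div, map_add, map_neg, h3x, h3y, h3ρ, D2,
    D3, smul_eq_mul, nsmul_eq_mul, Nat.cast_ofNat, mul_zero, add_zero, sub_zero,
    pow_one, Nat.add_one_sub_one, Derivation.map_one_eq_zero, neg_zero]
  ring

/-- `N₀`, the printed intermediate line (p.847 L74–81): the Leibniz expansion
"`(−½tr χ tr χ̲ + 2ρ)tr χ̲² + 2tr χ tr χ̲(−½tr χ̲²) − 5(−(3/2)tr χ̲ ρ)tr χ̲ − 5ρ(−½tr χ̲²) + 2tr χ̲(tr χ tr χ̲² − 5ρ tr χ̲)`"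
equals `½tr χ tr χ̲³ + 2ρ tr χ̲²`, and its last bracket is `∇₃(−tr χ tr χ̲ + 2ρ) = tr χ tr χ̲² − 5ρ tr χ̲`.
[cite: GiorgiKlainermanSzeftel2024, p.847 L74–81; GiorgiKlainermanSzeftel2022, l.34634–34635] -/
theorem N0_azero_line2 (d3 : Derivation ℤ K K) (x y ρ : K) (h3y : d3 y = -(1 / 2) * y ^ 2)
    (h3x : d3 x = -(1 / 2) * x * y + 2 * ρ) (h3ρ : d3 ρ = -(3 / 2) * y * ρ) :
    d3 (-(x * y) + 2 * ρ) = x * y ^ 2 - 5 * ρ * y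
    ∧ (-(1 / 2) * x * y + 2 * ρ) * y ^ 2 + 2 * x * y * (-(1 / 2) * y ^ 2) - 5 * (-(3 / 2) * y * ρ) * y
        - 5 * ρ * (-(1 / 2) * y ^ 2) + 2 * y * (x * y ^ 2 - 5 * ρ * y)
      = 1 / 2 * x * y ^ 3 + 2 * ρ * y ^ 2 := by
  obtain ⟨D2, -⟩ := D_num d3
  refine ⟨?_, by ring⟩
  simp only [d3.leibniz, map_add, map_neg, h3x, h3y, h3ρ, D2, smul_eq_mul, mul_zero,
    add_zero]
  ring

/-- `Z₃|_{a=0} = 0` (`[J]` p.847 L85–103 = `[v1]` l.34639–34641): the display "`Z₃ = ½tr χ tr χ̲² − 3tr χ̲ ρ − (23/4)tr χ tr χ̲²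
− 10tr χ̲ ρ − (5/4)tr χ̲² tr χ − ½tr χ tr χ̲² − tr χ̲ ρ + 2tr χ tr χ̲² − 10ρ tr χ̲ + 2tr χ̲(−tr χ tr χ̲ + 4ρ) − 2tr χ̲(−tr χ tr χ̲ + 2ρ −
5tr χ̲ tr χ + (5/2)tr χ̲ tr χ − 10ρ) = O(|a|r⁻⁴)`" — i.e. `I₃ + J₃ + K₃ + L₃ + N₃ + ∇₄C₁·(tr X̲ + tr X̲‾) − C₁ V̂` of the `Z₃`
definition with the §3 values, `tr X̲ + tr X̲‾ = 2tr χ̲`, `C₁ = 2tr χ̲` (the `η̲`- and `J₃ᵃ`-terms being `O(|a|)`) — sums to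
ZERO identically, with (K) read as `(5/2)tr χ̲ tr χ`.
[cite: GiorgiKlainermanSzeftel2024, p.847 L85–103, p.844 L22–23; GiorgiKlainermanSzeftel2022, l.34639–34641, l.34534–34535] -/
theorem Z3_azero (x y ρ : K) :
    1 / 2 * x * y ^ 2 - 3 * y * ρ - 23 / 4 * x * y ^ 2 - 10 * y * ρ - 5 / 4 * y ^ 2 * x - 1 / 2 * x * y ^ 2 - y * ρ
      + 2 * x * y ^ 2 - 10 * ρ * y + 2 * y * (-(x * y) + 4 * ρ)
      - 2 * y * (-(x * y) + 2 * ρ - 5 * y * x + 5 / 2 * y * x - 10 * ρ) = 0 := by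
  ring

/-- PRINT DATUM (K) in `Z₃`: read literally (`(5/2) tr χ tr χ` in the last bracket) the display of p.847 L85–103 sums to
`5 tr χ tr χ̲ (tr χ̲ − tr χ)`, which does not vanish in Schwarzschild.
[cite: GiorgiKlainermanSzeftel2024, p.847 L103; GiorgiKlainermanSzeftel2022, l.34641] -/
theorem Z3_azero_as_printed (x y ρ : K) :
    1 / 2 * x * y ^ 2 - 3 * y * ρ - 23 / 4 * x * y ^ 2 - 10 * y * ρ - 5 / 4 * y ^ 2 * x - 1 / 2 * x * y ^ 2 - y * ρ
      + 2 * x * y ^ 2 - 10 * ρ * y + 2 * y * (-(x * y) + 4 * ρ)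
      - 2 * y * (-(x * y) + 2 * ρ - 5 * y * x + 5 / 2 * x * x - 10 * ρ) = 5 * x * y * (y - x) := by
  ring

/-- `Z₀|_{a=0} = 0` (`[J]` p.848 L5–28 = `[v1]` l.34645–34647): "`Z₀ = ¾tr χ tr χ̲³ − 3tr χ̲² ρ − ½tr χ tr χ̲³ − 9ρ tr χ̲² −
(5/4)tr χ tr χ̲³ + 2tr χ̲² ρ − ¼tr χ tr χ̲³ + 2ρ tr χ̲² + ½tr χ tr χ̲³ + 2tr χ̲(−½tr χ tr χ̲² + 2tr χ̲ ρ) − ½tr χ̲²(−tr χ tr χ̲ + 2ρ −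
5tr χ̲ tr χ + (5/2)tr χ̲ tr χ − 10ρ) = O(|a|r⁻⁵)`" — `I₀ + … + N₀ + ∇₄C₂·2tr χ̲ − C₂V̂` — sums to ZERO, (K) read as
`(5/2)tr χ̲ tr χ`.
[cite: GiorgiKlainermanSzeftel2024, p.848 L5–28, p.844 L28–29; GiorgiKlainermanSzeftel2022, l.34645–34647, l.34537–34538] -/
theorem Z0_azero (x y ρ : K) :
    3 / 4 * x * y ^ 3 - 3 * y ^ 2 * ρ - 1 / 2 * x * y ^ 3 - 9 * ρ * y ^ 2 - 5 / 4 * x * y ^ 3 + 2 * y ^ 2 * ρ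
      - 1 / 4 * x * y ^ 3 + 2 * ρ * y ^ 2 + 1 / 2 * x * y ^ 3 + 2 * y * (-(1 / 2) * x * y ^ 2 + 2 * y * ρ)
      - 1 / 2 * y ^ 2 * (-(x * y) + 2 * ρ - 5 * y * x + 5 / 2 * y * x - 10 * ρ) = 0 := by
  ring

/-- PRINT DATUM (K) in `Z₀`: read literally the display of p.848 L5–28 sums to `(5/4) tr χ tr χ̲² (tr χ̲ − tr χ)`.
[cite: GiorgiKlainermanSzeftel2024, p.848 L28; GiorgiKlainermanSzeftel2022, l.34647] -/
theorem Z0_azero_as_printed (x y ρ : K) :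
    3 / 4 * x * y ^ 3 - 3 * y ^ 2 * ρ - 1 / 2 * x * y ^ 3 - 9 * ρ * y ^ 2 - 5 / 4 * x * y ^ 3 + 2 * y ^ 2 * ρ
      - 1 / 4 * x * y ^ 3 + 2 * ρ * y ^ 2 + 1 / 2 * x * y ^ 3 + 2 * y * (-(1 / 2) * x * y ^ 2 + 2 * y * ρ)
      - 1 / 2 * y ^ 2 * (-(x * y) + 2 * ρ - 5 * y * x + 5 / 2 * x * x - 10 * ρ)
      = 5 / 4 * x * y ^ 2 * (y - x) := by
  ring

/-- The two cancellations assembled from the NAMED pieces rather than the printed sums: with the §2–§3 values,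
`(I₃+J₃+K₃+L₃+N₃) + ∇₄C₁·(2tr χ̲) − (2tr χ̲)·V̂|_{a=0} = 0` and `(I₀+J₀+K₀+L₀+N₀) + ∇₄C₂·(2tr χ̲) − (½tr χ̲²)·V̂|_{a=0} = 0`.
[cite: GiorgiKlainermanSzeftel2024, p.844 L22–29, pp.846–848; GiorgiKlainermanSzeftel2022, l.34533–34538, l.34600–34648] -/
theorem Z3_Z0_azero_from_values (x y ρ : K) :
    ((1 / 2 * x * y ^ 2 - 3 * y * ρ) + (-(23 / 4) * x * y ^ 2 - 10 * y * ρ) + (-(5 / 4) * y ^ 2 * x)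
        + (-(1 / 2) * x * y ^ 2 - y * ρ) + (2 * x * y ^ 2 - 10 * ρ * y))
      + (-(x * y) + 4 * ρ) * (2 * y) - (2 * y) * (-(7 / 2) * x * y - 8 * ρ) = 0
    ∧ ((3 / 4 * x * y ^ 3 - 3 * y ^ 2 * ρ) + (-(1 / 2) * x * y ^ 3 - 9 * ρ * y ^ 2) + (-(5 / 4) * x * y ^ 3)
        + (-(1 / 4) * x * y ^ 3 + 2 * y ^ 2 * ρ) + (1 / 2 * x * y ^ 3 + 2 * ρ * y ^ 2))
      + (-(1 / 2) * x * y ^ 2 + 2 * y * ρ) * (2 * y) - (1 / 2 * y ^ 2) * (-(7 / 2) * x * y - 8 * ρ) = 0 := by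
  constructor <;> ring

end Coefficients

/-! ## §4. The exact lines for `Z₄₃` and `Z₄` (`[J]` p.844 L40 – p.845 L30) -/

section Exact

variable {K : Type*} [Field K] [CharZero K]

/-- `Z₄₃`, collection (`[J]` p.844 L42–45): with `I₄₃ = ∇₃C₁` (written `D`), `J₄₃ = −½tr X̲‾ tr X̲ − ((C₁ + tr X̲)/2)(tr X̲ +
tr X̲‾)`, `L₄₃ = ½tr X̲²` (the printed `I, J, L` lists), `Z₄₃ = I₄₃ + J₄₃ + L₄₃ + C₁(tr X̲ + tr X̲‾) = ∇₃C₁ + ½(tr X̲ + tr X̲‾)C₁ −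
tr X̲‾ tr X̲` (`tb = tr X̲`, `tbc = tr X̲‾`).
[cite: GiorgiKlainermanSzeftel2024, p.844 L40–45, p.830 L40–48 (I), p.836 L82–92 (J), p.839 L49–56 (L); GiorgiKlainermanSzeftel2022, l.34551–34553, l.34081, l.34282, l.34382] -/
theorem Z43_collect (D tb tbc C1 : K) :
    D + (-(1 / 2) * tbc * tb - (C1 + tb) / 2 * (tb + tbc)) + 1 / 2 * tb ^ 2 + C1 * (tb + tbc)
      = D + 1 / 2 * (tb + tbc) * C1 - tbc * tb := by
  ring

/-- `Z₄`, collection (`[J]` p.845 L7–12): with `I₄ = ∇₃C₂` (`D`), `J₄ = ¼tr X̲² tr X̲ − ¼tr X̲(tr X̲ + tr X̲‾)C₁`,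
`L₄ = −¼tr X̲³ + ¼tr X̲² C₁`: `Z₄ = I₄ + J₄ + L₄ + C₂(tr X̲ + tr X̲‾) = ∇₃C₂ + (tr X̲ + tr X̲‾)C₂ − ¼tr X̲ tr X̲‾ C₁`.
[cite: GiorgiKlainermanSzeftel2024, p.845 L7–12, p.830 L40–48 (I), p.836 L82–100 (J), p.839 L49–81 (L); GiorgiKlainermanSzeftel2022, l.34560–34561, l.34084, l.34283, l.34384] -/
theorem Z4_collect (D tb tbc C1 C2 : K) :
    D + (1 / 4 * tb ^ 2 * tb - 1 / 4 * tb * (tb + tbc) * C1) + (-(1 / 4) * tb ^ 3 + 1 / 4 * tb ^ 2 * C1)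
        + C2 * (tb + tbc)
      = D + (tb + tbc) * C2 - 1 / 4 * tb * tbc * C1 := by
  ring

omit [CharZero K] in
/-- `|tr X̲|² = tr χ̲² + ⁽ᵃ⁾tr χ̲²` for `tr X̲ = tr χ̲ − i⁽ᵃ⁾tr χ̲` (Definition 2.4.8), the substitution of p.844 L47–48.
[cite: GiorgiKlainermanSzeftel2024, Definition 2.4.8 p.113, p.844 L46–48; GiorgiKlainermanSzeftel2022, l.5053, l.34554] -/
theorem trXb_mul_conj (i y y' : K) (hi : i ^ 2 = -1) : (y + i * y') * (y - i * y') = y ^ 2 + y' ^ 2 := by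
  linear_combination (-(y' ^ 2)) * hi

/-- `Z₄₃`, reduction (`[J]` p.844 L46–61 = `[v1]` l.34554–34557): with `C₁ = 2tr χ̲ + C̃₁`, `tr X̲ = tr χ̲ − i⁽ᵃ⁾tr χ̲` and the
exact `∇₃^(c)tr χ̲ = −½(tr χ̲² − ⁽ᵃ⁾tr χ̲²)` (`e3c_trchb_out`; its `r⁻¹Γ_b` is outside the statement),
`∇₃C₁ + ½(tr X̲ + tr X̲‾)C₁ − tr X̲‾ tr X̲ = ∇₃C̃₁ + tr χ̲ C̃₁` — the form of `Z₄₃` stated in Proposition D.4.1.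
[cite: GiorgiKlainermanSzeftel2024, p.844 L46–61, p.823 L52 ff.; GiorgiKlainermanSzeftel2022, l.34554–34557, l.33825] -/
theorem Z43_reduce (d3 : Derivation ℤ K K) (i y y' Ct : K) (hi : i ^ 2 = -1)
    (h3y : d3 y = -(1 / 2) * (y ^ 2 - y' ^ 2)) :
    d3 (2 * y + Ct) + 1 / 2 * ((y - i * y') + (y + i * y')) * (2 * y + Ct) - (y + i * y') * (y - i * y')
      = d3 Ct + y * Ct := by
  obtain ⟨D2, -⟩ := D_num d3
  simp only [map_add, d3.leibniz, h3y, D2, smul_eq_mul, mul_zero, add_zero]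
  linear_combination (y' ^ 2) * hi

omit [CharZero K] in
/-- `Z₄₃`, the printed fourth line: "`−(tr χ̲² − ⁽ᵃ⁾tr χ̲²) + ∇₃C̃₁ + (2tr χ̲ + C̃₁)tr χ̲ − (tr χ̲² + ⁽ᵃ⁾tr χ̲²) = ∇₃C̃₁ + tr χ̲ C̃₁`"
(`D = ∇₃C̃₁`).
[cite: GiorgiKlainermanSzeftel2024, p.844 L54–61; GiorgiKlainermanSzeftel2022, l.34556–34557] -/
theorem Z43_line4 (y y' Ct D : K) :
    -(y ^ 2 - y' ^ 2) + D + (2 * y + Ct) * y - (y ^ 2 + y' ^ 2) = D + y * Ct := by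
  ring

/-- `Z₄`, reduction (`[J]` p.845 L13–30 = `[v1]` l.34562–34566): with `C₂ = ½tr χ̲² + C̃₂`, `C₁ = 2tr χ̲ + C̃₁`,
`∇₃C₂ + (tr X̲ + tr X̲‾)C₂ − ¼ tr X̲ tr X̲‾ C₁ = ∇₃C̃₂ + 2tr χ̲ C̃₂ − ¼(tr χ̲² + ⁽ᵃ⁾tr χ̲²)C̃₁` — the form stated in
Proposition D.4.1.
[cite: GiorgiKlainermanSzeftel2024, p.845 L13–30, p.823 L52 ff.; GiorgiKlainermanSzeftel2022, l.34562–34566, l.33826] -/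
theorem Z4_reduce (d3 : Derivation ℤ K K) (i y y' Ct Ct2 : K) (hi : i ^ 2 = -1)
    (h3y : d3 y = -(1 / 2) * (y ^ 2 - y' ^ 2)) :
    d3 (1 / 2 * y ^ 2 + Ct2) + ((y - i * y') + (y + i * y')) * (1 / 2 * y ^ 2 + Ct2)
        - 1 / 4 * (y - i * y') * (y + i * y') * (2 * y + Ct)
      = d3 Ct2 + 2 * y * Ct2 - 1 / 4 * (y ^ 2 + y' ^ 2) * Ct := by
  obtain ⟨D2, -⟩ := D_num d3
  simp only [map_add, d3.leibniz, d3.leibniz_pow, d3.leibniz_div, h3y, D2, smul_eq_mul, nsmul_eq_mul,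
    Nat.cast_ofNat, mul_zero, add_zero, pow_one, Nat.add_one_sub_one,
    Derivation.map_one_eq_zero, sub_zero]
  linear_combination (1 / 4 * y' ^ 2 * (2 * y + Ct)) * hi

/-- `Z₄`, the printed intermediate line (p.845 L17–30): "`tr χ̲(−½(tr χ̲² − ⁽ᵃ⁾tr χ̲²)) + ∇₃C̃₂ + (½tr χ̲² + C̃₂)2tr χ̲ −
¼(2tr χ̲ + C̃₁)(tr χ̲² + ⁽ᵃ⁾tr χ̲²) = ∇₃C̃₂ + 2tr χ̲ C̃₂ − ¼(tr χ̲² + ⁽ᵃ⁾tr χ̲²)C̃₁`" (`D = ∇₃C̃₂`).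
[cite: GiorgiKlainermanSzeftel2024, p.845 L17–30; GiorgiKlainermanSzeftel2022, l.34564–34566] -/
theorem Z4_line4 (y y' Ct Ct2 D : K) :
    y * (-(1 / 2) * (y ^ 2 - y' ^ 2)) + D + (1 / 2 * y ^ 2 + Ct2) * (2 * y)
        - 1 / 4 * (2 * y + Ct) * (y ^ 2 + y' ^ 2)
      = D + 2 * y * Ct2 - 1 / 4 * (y ^ 2 + y' ^ 2) * Ct := by
  ring

end Exact

/-! ## §5. Proposition D.4.3: the wave equation for `Q(A)` — coefficient bookkeeping and `Ṽ` -/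

section WaveEqQ

variable {K : Type*} [Field K] [CharZero K]

/-- Coefficient of `∇₃Q` (READING (W)).  (4.7.12) gives `□̇₂Q` the coefficient `2ω − ½tr X`; the display "Applying
the definition of 𝓛 …" (p.848 L76) gives `𝓛(Q)` the coefficient `−½tr X − 2tr X‾ + cω` with `c = −2` as printed
(`c = +2` by Lemma 2.2.17 on the type-`(−1)` tensor `∇₃Q`, `c = 0` in the next display p.849 L15); the difference, which
is the coefficient of `∇₃Q` in `□̇₂Q − 𝓛(Q)` and hence in (D.4.14), is `2tr X‾ + (2 − c)ω`: `2tr X‾` for `c = 2`,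
`2tr X‾ + 4ω` for `c = −2`.  (D.4.14) prints `2tr X‾`; at `ω = 0` (Kerr, outgoing normalization: p.157 L97–99) all
readings agree.
[cite: GiorgiKlainermanSzeftel2024, (4.7.12) p.183 L5–20, p.848 L69–88, p.849 L14–23, (D.4.14) p.848 L40–47, Lemma 2.2.17 p.105 L7–11, p.157 L97–99; GiorgiKlainermanSzeftel2022, l.8282–8287, l.34692–34701, l.34669, l.4562–4565, l.7145] -/
theorem waveQ_coeff3 (X Xc ω c : K) :
    (2 * ω - 1 / 2 * X) - (-(1 / 2) * X - 2 * Xc + c * ω) = 2 * Xc + (2 - c) * ω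
    ∧ (2 * ω - 1 / 2 * X) - (-(1 / 2) * X - 2 * Xc + 2 * ω) = 2 * Xc
    ∧ (2 * ω - 1 / 2 * X) - (-(1 / 2) * X - 2 * Xc - 2 * ω) = 2 * Xc + 4 * ω := by
  refine ⟨by ring, by ring, by ring⟩

/-- Coefficient of `∇₄Q`.  Moving the commutator's `−2tr χ̲ ∇₄Q(A) = −(tr X̲ + tr X̲‾)∇₄Q` ((D.4.4)) to the left of
(D.4.2) turns `𝓛(Q)`'s `−½tr X̲` into the printed "`−((3/2)tr X̲ + tr X̲‾)`" (p.849 L15–16); against `□̇₂Q`'s `−½tr X̲`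
((4.7.12)) the coefficient of `∇₄Q` in (D.4.14) is `tr X̲ + tr X̲‾`.
[cite: GiorgiKlainermanSzeftel2024, p.849 L5–24, (D.4.14) p.848 L40–47; GiorgiKlainermanSzeftel2022, l.34697–34701, l.34669] -/
theorem waveQ_coeff4 (Xb Xbc : K) :
    -(1 / 2) * Xb - (Xb + Xbc) = -(3 / 2 * Xb + Xbc)
    ∧ -(1 / 2) * Xb - (-(3 / 2 * Xb + Xbc)) = Xb + Xbc := by
  constructor <;> ring

omit [CharZero K] in
/-- Coefficient of `∇Q` (componentwise scalar shadow).  `𝓛(Q)` has `4H + H̲ + H̲‾`, the commutator adds `4η̲` (p.849 L23: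
"`4H + H̲ + H̲‾ + 4η̲`"), `□̇₂Q` has `2η̲` ((4.7.12)); the coefficient in (D.4.14) is
`2η̲ − (4H + H̲ + H̲‾ + 4η̲) = −(4H + 2H̲ + 2H̲‾)` because `H̲ + H̲‾ = 2η̲` (`H̲ = η̲ + i*η̲`, Definition 2.4.8; components
`Hb = eb + i·seb`, `Hbc = eb − i·seb`).
[cite: GiorgiKlainermanSzeftel2024, p.849 L23, (D.4.14) p.848 L40–47, Definition 2.4.8 p.113; GiorgiKlainermanSzeftel2022, l.34699, l.34669, l.5048] -/
theorem waveQ_coeffH (i H eb seb : K) :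
    2 * eb - (4 * H + (eb + i * seb) + (eb - i * seb) + 4 * eb)
      = -(4 * H + 2 * (eb + i * seb) + 2 * (eb - i * seb)) := by
  ring

/-- `Ṽ` ((D.4.15) from the last display of the proof, p.849 L46–57 = `[v1]` l.34708–34711): with
`tr X = tr χ − i⁽ᵃ⁾tr χ`, `tr X̲ = tr χ̲ − i⁽ᵃ⁾tr χ̲`, `P̄ = ρ − i*ρ` (Definition 2.4.8) — symbols `x, x' = tr χ, ⁽ᵃ⁾tr χ`,
`y, y' = tr χ̲, ⁽ᵃ⁾tr χ̲`, `sr = *ρ`, `ee = η·η̲`, `ew = η∧η̲`, `Vh = V̂` —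
"`Ṽ = −½tr χ tr χ̲ − ½⁽ᵃ⁾tr χ⁽ᵃ⁾tr χ̲ − 2ρ + 2i(*ρ − η∧η̲) − (−tr X‾ tr X̲ + 2P̄ + V̂ + 4η·η̲ − 4iη∧η̲)`"
`= ½tr χ tr χ̲ + ½⁽ᵃ⁾tr χ⁽ᵃ⁾tr χ̲ − 4ρ − 4η·η̲ + i(−tr χ⁽ᵃ⁾tr χ̲ + ⁽ᵃ⁾tr χ tr χ̲ + 4*ρ + 2η∧η̲) − V̂`, which is (D.4.15).
[cite: GiorgiKlainermanSzeftel2024, (D.4.15) p.848 L49–58, p.849 L46–57; GiorgiKlainermanSzeftel2022, l.34674–34679, l.34708–34711] -/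
theorem Vtilde_eq (i x x' y y' ρ sr ee ew Vh : K) (hi : i ^ 2 = -1) :
    (-(1 / 2) * x * y - 1 / 2 * x' * y' - 2 * ρ + 2 * i * (sr - ew))
        - (-((x + i * x') * (y - i * y')) + 2 * (ρ - i * sr) + Vh + 4 * ee - 4 * i * ew)
      = (1 / 2 * x * y + 1 / 2 * x' * y' - 4 * ρ - 4 * ee)
        + i * (-(x * y') + x' * y + 4 * sr + 2 * ew) - Vh := by
  linear_combination (-(x' * y')) * hi

omit [CharZero K] in
/-- The `Q`-coefficient bookkeeping behind `Vtilde_eq`: `□̇₂Q`'s zeroth-order coefficient ((4.7.12)) minus the one of the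
display p.849 L23 (`−tr X‾tr X̲ + 2P̄ + V̂ + 4η·η̲ − 4iη∧η̲`, i.e. `𝓛`'s (5.1.2)+(D.2.1) coefficient plus the commutator's
`V̂`) is what multiplies `Q` in (D.4.14); this is literally the subtraction displayed at p.849 L49–53.
[cite: GiorgiKlainermanSzeftel2024, p.849 L23–53, (5.1.2) p.188, (D.2.1) p.819 L78–84; GiorgiKlainermanSzeftel2022, l.34703–34711, l.8573–8578, l.33630] -/
theorem waveQ_coeff0 (w0 nL Vh : K) : w0 - (nL + Vh) = (w0 - nL) - Vh := by
  ring

end WaveEqQ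

/-! ## §6. Proposition D.4.4: the rescaling `𝔮 = f Q`, `f = qⁿ q̄ᵐ`, `m = 4 − n`, `n = 1` -/

section Rescaling

variable {K : Type*} [Field K] [CharZero K]

/-- Leibniz rule behind "`∇₃(f) = (n/2 tr X̲‾ + m/2 tr X̲)f`, `∇₄(f) = (n/2 tr X + m/2 tr X‾)f`,
`∇f = (m/2 H + n/2 H‾ + n/2 H̲ + m/2 H̲‾)f`" for `f = qⁿq̄ᵐ` (p.850 L7–31): if a derivation satisfies `Dq = αq` and
`Dq̄ = βq̄` then `D(qⁿq̄ᵐ) = (nα + mβ)qⁿq̄ᵐ`.  The values of `α, β` are those of Lemma 3.4.1 (3.4.4):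
`∇₃q = ½tr X̲‾ q` (`GRWTransformationAlgebra.nabla3_q_out`), `∇₄q = ½tr X q` (`nabla4_q_out`), `∇q = ½(H̲ + H‾)q`
(componentwise), and their conjugates.
[cite: GiorgiKlainermanSzeftel2024, p.850 L5–31, Lemma 3.4.1 (3.4.4) p.131 L10–20; GiorgiKlainermanSzeftel2022, l.34743–34751, l.5924–5931] -/
theorem D_monomial (D : Derivation ℤ K K) (q qb α β : K) (n m : ℕ) (hq : D q = α * q) (hqb : D qb = β * qb) :
    D (q ^ n * qb ^ m) = (n * α + m * β) * (q ^ n * qb ^ m) := by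
  rw [D.leibniz, D.leibniz_pow, D.leibniz_pow, hq, hqb]
  simp only [smul_eq_mul, nsmul_eq_mul]
  rcases Nat.eq_zero_or_pos n with hn | hn <;> rcases Nat.eq_zero_or_pos m with hm | hm
  · subst hn; subst hm; simp
  · subst hn
    obtain ⟨k, rfl⟩ := Nat.exists_eq_add_of_le hm
    simp only [pow_zero, one_mul, Nat.cast_zero, zero_mul, zero_add, mul_zero,
      Nat.add_sub_cancel_left, Nat.cast_add, Nat.cast_one, pow_zero]
    ring
  · subst hm
    obtain ⟨k, rfl⟩ := Nat.exists_eq_add_of_le hn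
    simp only [pow_zero, mul_one, Nat.cast_zero, zero_mul, add_zero, mul_zero,
      Nat.add_sub_cancel_left, Nat.cast_add, Nat.cast_one, zero_add]
    ring
  · obtain ⟨k, rfl⟩ := Nat.exists_eq_add_of_le hn
    obtain ⟨l, rfl⟩ := Nat.exists_eq_add_of_le hm
    simp only [Nat.add_sub_cancel_left, Nat.cast_add, Nat.cast_one]
    ring

/-- The three printed coefficient forms of p.850 L9–31 are `nα + mβ` for the three pairs `(α, β)`:
`n(½tr X̲‾) + m(½tr X̲)`, `n(½tr X) + m(½tr X‾)`, and `n·½(H‾ + H̲) + m·½(H + H̲‾) = m/2 H + n/2 H‾ + n/2 H̲ + m/2 H̲‾`.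
[cite: GiorgiKlainermanSzeftel2024, p.850 L9–31; GiorgiKlainermanSzeftel2022, l.34747–34751] -/
theorem resc_leibniz_coeffs (n m Xb Xbc X Xc H Hc Hb Hbc : K) :
    n * (1 / 2 * Xbc) + m * (1 / 2 * Xb) = n / 2 * Xbc + m / 2 * Xb
    ∧ n * (1 / 2 * X) + m * (1 / 2 * Xc) = n / 2 * X + m / 2 * Xc
    ∧ n * (1 / 2 * (Hc + Hb)) + m * (1 / 2 * (H + Hbc)) = m / 2 * H + n / 2 * Hc + n / 2 * Hb + m / 2 * Hbc := by
  refine ⟨by ring, by ring, by ring⟩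

/-- "which gives" (p.850 L66–88 = `[v1]` l.34762–34766): collecting the first-order coefficients of
`□̇₂𝔮 = □(f)Q + f□̇₂Q − ∇₃f∇₄Q − ∇₄f∇₃Q + 2∇f·∇Q` with (D.4.14) and the Leibniz values:
`∇₄Q`: `(tr X̲ + tr X̲‾) − (n/2 tr X̲‾ + m/2 tr X̲) = (1 − n/2)tr X̲‾ + (1 − m/2)tr X̲`;
`∇₃Q`: `2tr X‾ − (n/2 tr X + m/2 tr X‾) = −(n/2)tr X + (2 − m/2)tr X‾`;
`∇Q`: `−(4H + 2H̲ + 2H̲‾) + 2(m/2 H + n/2 H‾ + n/2 H̲ + m/2 H̲‾) = (m − 4)H + nH‾ + (n − 2)H̲ + (m − 2)H̲‾`.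
[cite: GiorgiKlainermanSzeftel2024, p.850 L32–88; GiorgiKlainermanSzeftel2022, l.34752–34766] -/
theorem resc_collect (n m Xb Xbc X Xc H Hc Hb Hbc : K) :
    (Xb + Xbc) - (n / 2 * Xbc + m / 2 * Xb) = (1 - n / 2) * Xbc + (1 - m / 2) * Xb
    ∧ 2 * Xc - (n / 2 * X + m / 2 * Xc) = -(n / 2) * X + (2 - m / 2) * Xc
    ∧ -(4 * H + 2 * Hb + 2 * Hbc) + 2 * (m / 2 * H + n / 2 * Hc + n / 2 * Hb + m / 2 * Hbc)
        = (m - 4) * H + n * Hc + (n - 2) * Hb + (m - 2) * Hbc := by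
  refine ⟨by ring, by ring, by ring⟩

/-- "the real part of the coefficients of all the first derivatives are multiple of `m + n − 4`" (p.850 L93–94): with
`tr X̲ = y − iy'`, `tr X = x − ix'`, `H = e + i·se`, `H̲ = eb + i·seb` (componentwise) and their conjugates, the three
coefficients of `resc_collect` are
`−½(m+n−4)y + i((m−n)/2)y'`, `−½(m+n−4)x + i((n−m+4)/2)x'`, `(m+n−4)(e + eb) + i((m−4−n)se + (n−m)seb)`.
[cite: GiorgiKlainermanSzeftel2024, p.850 L93–94, Definition 2.4.8 p.113; GiorgiKlainermanSzeftel2022, l.34766, l.5048–5053] -/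
theorem resc_real_parts (i n m x x' y y' e se eb seb : K) :
    (1 - n / 2) * (y + i * y') + (1 - m / 2) * (y - i * y')
        = -(1 / 2) * (m + n - 4) * y + i * ((m - n) / 2 * y')
    ∧ -(n / 2) * (x - i * x') + (2 - m / 2) * (x + i * x')
        = -(1 / 2) * (m + n - 4) * x + i * ((n - m + 4) / 2 * x')
    ∧ (m - 4) * (e + i * se) + n * (e - i * se) + (n - 2) * (eb + i * seb) + (m - 2) * (eb - i * seb)
        = (m + n - 4) * (e + eb) + i * ((m - 4 - n) * se + (n - m) * seb) := by
  refine ⟨by ring, by ring, by ring⟩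

/-- `m = 4 − n` (p.850 L95–122 = `[v1]` l.34767–34773): the coefficients become
"`(1 − n/2)tr X̲‾ − (1 − n/2)tr X̲`, `−(n/2)tr X + (n/2)tr X‾`, `(−n)H + nH‾ + (n−2)H̲ + (2−n)H̲‾`", i.e. purely imaginary:
`i(2 − n)⁽ᵃ⁾tr χ̲`, `i n ⁽ᵃ⁾tr χ`, `i((−2n)*η + 2(n − 2)*η̲)`.
[cite: GiorgiKlainermanSzeftel2024, p.850 L95–122; GiorgiKlainermanSzeftel2022, l.34767–34773] -/
theorem resc_m_eq (i n x x' y y' e se eb seb : K) :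
    (1 - n / 2) * (y + i * y') + (1 - (4 - n) / 2) * (y - i * y')
        = (1 - n / 2) * (y + i * y') - (1 - n / 2) * (y - i * y')
    ∧ (1 - n / 2) * (y + i * y') - (1 - n / 2) * (y - i * y') = i * ((2 - n) * y')
    ∧ -(n / 2) * (x - i * x') + (2 - (4 - n) / 2) * (x + i * x') = -(n / 2) * (x - i * x') + n / 2 * (x + i * x')
    ∧ -(n / 2) * (x - i * x') + n / 2 * (x + i * x') = i * (n * x')
    ∧ ((4 - n) - 4) * (e + i * se) + n * (e - i * se) + (n - 2) * (eb + i * seb) + ((4 - n) - 2) * (eb - i * seb)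
        = -n * (e + i * se) + n * (e - i * se) + (n - 2) * (eb + i * seb) + (2 - n) * (eb - i * seb)
    ∧ -n * (e + i * se) + n * (e - i * se) + (n - 2) * (eb + i * seb) + (2 - n) * (eb - i * seb)
        = i * (-(2 * n) * se + 2 * (n - 2) * seb) := by
  refine ⟨by ring, by ring, by ring, by ring, by ring, by ring⟩

omit [CharZero K] in
/-- `n = 1` (p.851 L5–23): the operator is `i(⁽ᵃ⁾tr χ̲ ∇₄ + ⁽ᵃ⁾tr χ ∇₃ + (−2*η − 2*η̲)·∇)` — the three coefficients at
`n = 1` are `⁽ᵃ⁾tr χ̲`, `⁽ᵃ⁾tr χ`, and `−2(*η + *η̲)` componentwise.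
[cite: GiorgiKlainermanSzeftel2024, p.850 L118–122, p.851 L5–17; GiorgiKlainermanSzeftel2022, l.34774–34782] -/
theorem resc_n_one (x' y' se seb : K) :
    (2 - (1 : K)) * y' = y' ∧ (1 : K) * x' = x' ∧ -(2 * (1 : K)) * se + 2 * ((1 : K) - 2) * seb = -2 * (se + seb) := by
  refine ⟨by ring, by ring, by ring⟩

omit [CharZero K] in
/-- The dual swap used at `n = 1`: for horizontal 1-forms in an oriented orthonormal basis, `(*ξ)₁ = ∈₁₂ξ₂ = ξ₂`,
`(*ξ)₂ = ∈₂₁ξ₁ = −ξ₁` (Definition 2.1.7), so `−2(*ξ)·v = 2 ξ·(*v)` (Lemma 2.1.10: `*ξ·η = −ξ·*η`); with `ξ = η + η̲`,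
`v = ∇` this turns `−2(*η + *η̲)·∇` into the `+2(η + η̲)·*∇` of (4.1.14).
[cite: GiorgiKlainermanSzeftel2024, Definition 2.1.7 p.67 L53–62, Lemma 2.1.10 p.68 L32–36, p.851 L5–17; GiorgiKlainermanSzeftel2022, l.2667, l.2714, l.34775–34781] -/
theorem dual_pairing_swap (ξ₁ ξ₂ v₁ v₂ : K) :
    -2 * (ξ₂ * v₁ + -ξ₁ * v₂) = 2 * (ξ₁ * v₂ + ξ₂ * -v₁) := by
  ring

end Rescaling

/-! ## §7. The frame identities `[J]` (3.4.3) in exact Kerr, outgoing principal frame -/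

section TFrame

variable {K : Type*} [Field K] [CharZero K]

/-- `(η + η̲)₂ = 0` in Kerr (canonical basis): `η₂ = a r sin θ/|q|³ = −η̲₂` (`GRWTransformationAlgebra.eta2/etab2`), so
`2(η + η̲)·*∇ = 2(η + η̲)₁ *e₁ + 2(η + η̲)₂ *e₂ = 2(η + η̲)₁ e₂` as written at `[J]` p.130 L63 (`*e₁ = e₂`).
[cite: GiorgiKlainermanSzeftel2024, p.124 L86–131, p.127 L166–202, p.130 L62–63; GiorgiKlainermanSzeftel2022, l.5559–5566, l.5741–5748, l.5896] -/
theorem eta_add_etab_2 (r a s n : K) : eta2 r a s n + etab2 r a s n = 0 := by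
  unfold eta2 etab2
  ring

omit [CharZero K] in
/-- `[J]` (3.4.3), first identity, exact Kerr, outgoing frame `e₄ = ((r²+a²)/Δ)∂ₜ + ∂ᵣ + (a/Δ)∂_φ`,
`e₃ = ((r²+a²)∂ₜ − Δ∂ᵣ + a∂_φ)/|q|²` (p.126 L67–95) and `T̂ = ∂ₜ + (a/(r²+a²))∂_φ` (p.123 L81): componentwise over
`(∂ₜ, ∂ᵣ, ∂_φ)` (no `∂_θ` occurs), `⁽ᵃ⁾tr χ e₃ + ⁽ᵃ⁾tr χ̲ e₄ = (4a cos θ (r²+a²)/|q|⁴) T̂` with `⁽ᵃ⁾tr χ = 2a cos θ/|q|²`,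
`⁽ᵃ⁾tr χ̲ = 2aΔcos θ/|q|⁴` (`atrchO`, `atrchbO`).
[cite: GiorgiKlainermanSzeftel2024, (3.4.3) p.130 L6–23, L25–54, p.126 L67–95, p.123 L81; GiorgiKlainermanSzeftel2022, l.5885, l.5889–5894, l.5683–5687, l.5497] -/
theorem tframe_hat_out (r a m c : K) (hN : nsq r a c ≠ 0) (hD : Del r a m ≠ 0) (hra : r ^ 2 + a ^ 2 ≠ 0) :
    atrchO r a c * ((r ^ 2 + a ^ 2) / nsq r a c) + atrchbO r a m c * ((r ^ 2 + a ^ 2) / Del r a m)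
        = 4 * a * c * (r ^ 2 + a ^ 2) / nsq r a c ^ 2 * 1
    ∧ atrchO r a c * (-(Del r a m / nsq r a c)) + atrchbO r a m c * 1 = 0
    ∧ atrchO r a c * (a / nsq r a c) + atrchbO r a m c * (a / Del r a m)
        = 4 * a * c * (r ^ 2 + a ^ 2) / nsq r a c ^ 2 * (a / (r ^ 2 + a ^ 2)) := by
  unfold atrchO atrchbO
  refine ⟨?_, ?_, ?_⟩
  · field_simp; ring
  · field_simp; ring
  · field_simp; ring

omit [CharZero K] in
/-- `[J]` (3.4.3), second identity, exact Kerr, outgoing frame — the identity (4.1.14) invoked at the end of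
Proposition D.4.4 (p.851 L5–13, "`+ Γ_g·𝔡`" in perturbations): with the canonical basis `e₂ = (a sin θ/|q|)∂ₜ +
(1/(|q| sin θ))∂_φ` ((3.3.3)), `*e₁ = e₂`, `(η + η̲)₁ = η₁ + η̲₁ = −2a² sin θ cos θ/|q|³`, `(η + η̲)₂ = 0`
(`eta_add_etab_2`), componentwise over `(∂ₜ, ∂ᵣ, ∂_φ)`:
`⁽ᵃ⁾tr χ e₃ + ⁽ᵃ⁾tr χ̲ e₄ + 2(η + η̲)₁ e₂ = (4a cos θ/|q|²) ∂ₜ` (`n = |q|`, `s = sin θ`, `s² + cos²θ = 1`).  The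
intermediate values of p.130 L62–91 (`2(η + η̲)₁e₂ = −(4a³sin²θ cos θ/|q|⁴)∂ₜ − (4a²cos θ/|q|⁴)∂_φ`) are the `η`-summands
below.
[cite: GiorgiKlainermanSzeftel2024, (3.4.3) p.130 L6–23, L62–91, (4.1.14) p.160 L5–20, (3.3.3) p.123 L60–77, p.851 L5–13; GiorgiKlainermanSzeftel2022, l.5886, l.5895–5904, l.7262–7267, l.5491, l.34775–34777] -/
theorem tframe_T_out (r a m c s n : K) (hn : n ^ 2 = nsq r a c) (hn0 : n ≠ 0) (hD : Del r a m ≠ 0)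
    (hs : s ≠ 0) (hsc : s ^ 2 + c ^ 2 = 1) :
    atrchO r a c * ((r ^ 2 + a ^ 2) / nsq r a c) + atrchbO r a m c * ((r ^ 2 + a ^ 2) / Del r a m)
        + 2 * (eta1 a c s n + etab1 a c s n) * (a * s / n) = 4 * a * c / nsq r a c
    ∧ atrchO r a c * (-(Del r a m / nsq r a c)) + atrchbO r a m c * 1 + 2 * (eta1 a c s n + etab1 a c s n) * 0 = 0
    ∧ atrchO r a c * (a / nsq r a c) + atrchbO r a m c * (a / Del r a m)
        + 2 * (eta1 a c s n + etab1 a c s n) * (1 / (n * s)) = 0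
    ∧ 2 * (eta1 a c s n + etab1 a c s n) * (a * s / n) = -(4 * a ^ 3 * s ^ 2 * c / n ^ 4)
    ∧ 2 * (eta1 a c s n + etab1 a c s n) * (1 / (n * s)) = -(4 * a ^ 2 * c / n ^ 4) := by
  have hN : nsq r a c ≠ 0 := nsq_ne_zero_of_sq r a c n hn hn0
  have hN' : r ^ 2 + a ^ 2 * c ^ 2 ≠ 0 := by unfold nsq at hN; exact hN
  have hs2 : s ^ 2 = 1 - c ^ 2 := by linear_combination hsc
  have hn4 : n ^ 4 = nsq r a c ^ 2 := by rw [← hn]; ring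
  have h1 : 2 * (eta1 a c s n + etab1 a c s n) * (a * s / n) = -(4 * a ^ 3 * s ^ 2 * c / n ^ 4) := by
    unfold eta1 etab1; field_simp; ring
  have h2 : 2 * (eta1 a c s n + etab1 a c s n) * (1 / (n * s)) = -(4 * a ^ 2 * c / n ^ 4) := by
    unfold eta1 etab1; field_simp; ring
  refine ⟨?_, ?_, ?_, h1, h2⟩
  · rw [h1, hn4, hs2]
    unfold atrchO atrchbO
    unfold nsq at *
    field_simp
    ring
  · unfold atrchO atrchbO
    field_simp
    ring
  · rw [h2, hn4]
    unfold atrchO atrchbO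
    field_simp
    ring

end TFrame

end Literature.Geometry.Lorentzian.GiorgiKlainermanSzeftel2022.ZCoefficientLedger
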